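import Summits.KontsevichZagierPeriods.KontsevichZagierPeriods.Theses.LinRedNormalForm
import Literature.Barriers.KontsevichZagierPeriods.GrothendieckPeriodConjectureDependenceProofs
import Literature.NumberTheory.Transcendental.MZVSimplexRep
import Literature.NumberTheory.Transcendental.KZSliceFubini
import Literature.NumberTheory.Transcendental.SemialgebraicMapsProofs
import Literature.Barriers.KontsevichZagierPeriods.AlgebraicPrimitivesObstruction

/-!
# Disproof of `ArrangementNormalForm` — findings

Standing adversary file for crux `stmt-KontsevichZagierPeriods-3915`
(`Summit.KontsevichZagierPeriods.KontsevichZagierPeriods.Theses.LinRedNormalForm.ArrangementNormalForm`):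
every absolutely convergent `[open rational polyhedral cell, P/∏ Lⱼ^{eⱼ}]` is KZ-equivalent to a
`ℤ`-combination of hyperlogarithm word representations `[Δ_w, q · ∏ᵢ (tᵢ − aᵢ)⁻¹]`, `aᵢ ∈ ℚ`.

Index of what is CHECKED in this file (prose only in docstrings):

* §0  `wordReps`, `arrangementNormalForm_iff` — the target class, definitional unfolding.
* §1  `logSpan`, `one_not_mem_logSpan` — the `ℚ`-span of logarithms of positive rationals does not
      contain `1` (Hermite–Lindemann, from the tree's PROVED `irrational_log_ratCast`).
* §2  weight-one words: `value_mem_logSpan_of_wordRep_one` (a convergent weight-one word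
      `[(0,1), q/(t−a)]` has value `q·log((1−a)/(−a)) ∈ logSpan`) and the TIGHTNESS lemma
      `letter_not_mem_Icc_of_wordRep_one` (a letter in `[0,1]` forces `q = 0`).
* §3  `evalDim`, `relationsWithoutNL` — evaluation filtered by dimension kills every move except
      Newton–Leibniz (the three other move sets are dimension-homogeneous).
* §4  LOAD-BEARING: `ArrangementNormalFormWithoutNewtonLeibniz` and
      `arrangementNormalForm_false_without_newtonLeibniz` — with rules (1a), (1b), (2) only the
      crux fails already for `∫₀¹ 1 dx = 1` (dimension is then a move invariant and `1 ∉ logSpan`).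
      Any proof must use rule (3) to drop weight/dimension.
* §5  STRENGTHENING refuted: `SameWeightNormalForm` (words of weight = dimension only) is false
      (`not_sameWeightNormalForm`): the normal form of an `n`-dimensional arrangement integral must
      mix weights `0 … n` (`∫₀¹ 1 = 1`, `∫₀¹ dx/(x+1)² = 1/2`).
* §6  DEGENERATE INSTANCES HOLD (no junk refutation): `of_mem_relations_of_domain_eq_empty`,
      `arrangementNormalForm_dim_zero` — empty cells and `n = 0` satisfy the crux.
* §7  NEAR-MISSES (sorried, with the obstruction): dropping the cell hypothesis or the linear-form
      hypothesis reduces to OPEN transcendence (`π ∉ H`, `√2 ∉ H` for the hyperlog value span `H`);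
      no move invariant finer than the value is known (= kill criterion (1) of the route = ¬KZ).
* §8  `not_integrableOn_partialFractionPiece` — the `∞ − ∞` certified: on the unit square the
      partial-fraction piece `1/(x(1+x+y))` is not an `IntegralRep` (not absolutely integrable), so
      the naive first move of the reduction of `1/((1+x+y)(1+2x+y))` is not a rule instance.
* §9  POSITIVE BY-PRODUCT `WordReps.exists_wordRep` / `WordReps.integrableOn_wordIntegrand`: every
      ADMISSIBLE rational word (`aᵢ ∉ (0,1)`, `a₀ ≠ 1`, `a_{w−1} ≠ 0`) has a representation of KZ's
      literal rational shape — what a prover needs to instantiate `c` (all three cruxes 3912/3914/3915).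
* §10 LOAD-BEARING (rule 2): `NoCoV.arrangementNormalForm_false_without_changeOfVariables` — the
      crux is FALSE for rules (1a), (1b), (3) only. NEW INVARIANT of the CoV-free calculus: the slice
      density class `D [σ,f] = (s ↦ ∫_{σ_s} f) mod (null functions + ℤ-span of exact ℚ-semialgebraic
      densities 1_{[a,b]}·F')`. Witness `[(1,2), 1/x]`. COROLLARY
      `NoCoV.kzConjecture_false_without_changeOfVariables`: the RATIONAL pair `[(1,2),1/x]`,
      `[(0,1),1/(t+1)]` (both `= log 2`) is not related without rule (2) — rule (2) is independent of
      rules (1), (3) even on equal-value rational pairs (Conjecture 1 fails for the sub-calculus).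
* §11 TIGHTNESS in every weight `WordTight.wordRep_admissible`: a word representation with `q ≠ 0`
      has an admissible word (no interior letter, `a₀ ≠ 1`, `a_{w−1} ≠ 0`) — adapted grid box +
      `i`-th marginal (`Measure.pi_map_eval`) + `intervalIntegrable_sub_inv_iff`. With §9: the
      generators of the target class with `q ≠ 0` are EXACTLY the admissible rational words.
* §12 TRANSFER to the sibling crux DihedralNormalForm (stmt-3912):
      `dihedralNormalForm_false_without_newtonLeibniz` — same witness `[Δ₁, 1]`, weight-one MZV
      words do not exist, so rule (3) is load-bearing there as well.
Sibling evidence files on the item: `NegA.lean` (sorry-free extract of §1–§4), `WordReps.lean` (§9),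
`NoCoV.lean` (§10), `WordTight.lean` (§11), kit job j005345 (`arr2d_pslq.py`: value-level PSLQ census of ~300 convergent
2-dim rational arrangement integrals against the weight-≤2 convergent hyperlog basis over S = {2,3,5}; still QUEUED after
> 6 h on a saturated farm when cycle 1 closed — its summary/manifest attach to the item automatically when it runs; no
value-level counterexample is possible in principle (values ∈ H), the census only supplies explicit conjectural normal forms).

WHY THE CRUX RESISTS (summary for provers). (i) Value level: arrangements are linearly reducible in
every order with rational letters (resultants of `x₁`-linear forms with constant `x₁`-coefficients are
affine-linear), so values lie in `H[iπ]` (Brown 2009, Panzer 2015) and, being real, in `H` itself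
(odd powers of `iπ` are purely imaginary against real `H`-coefficients; `π² = 6ζ(2) ∈ H`; `H` is a
shuffle algebra; regularised words are polynomial in convergent ones). No value-level counterexample.
(ii) Junk level: `n = 0`, empty cells, null sets, zero integrands are all relations (§6). (iii) Move
level: `relations ≤ ker eval` is the ONLY invariant available; separating `[r]` from the word closure
needs an additive invariant vanishing on all four move sets and finer than the value, which would
refute the summit itself. (iv) What a proof must do (§4, §5, §10): use Newton–Leibniz with
ALGEBRAIC primitives to drop dimension, use change of variables (the slice density class of §10 is
invariant under everything else), and produce mixed-weight normal forms; the first non-trivial test is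
`∫∫_{(0,1)²} dx dy/((1+x+y)(1+2x+y))`, where integrand additivity in `y` produces the non-integrable
pieces `±1/(x(1+x+y))`, `∓1/(x(1+2x+y))` on the square (the `∞ − ∞` of the route text): a move chain
must blow up the corner `x = 0` first (rule 2 on cells + rule 1a).
-/

noncomputable section

set_option linter.dupNamespace false

namespace Summit.KontsevichZagierPeriods.KontsevichZagierPeriods.Cruxes.ArrangementNormalForm.Disproof

open MeasureTheory Set
open Literature.NumberTheory.Transcendental
open Summit.KontsevichZagierPeriods.KontsevichZagierPeriods.Theses.LinRedNormalForm

/-! ## §0 The target class -/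

/-- The open ordered simplex `{1 > t₀ > ⋯ > t_{w-1} > 0}` exactly as inlined in the route file
(definitionally `KZ.openOrderedSimplex w`). -/
def simplex (w : ℕ) : Set (Fin w → ℝ) := {t | (∀ i, 0 < t i) ∧ (∀ i, t i < 1) ∧ StrictAnti t}

/-- The target class of the crux: hyperlogarithm WORD representations with rational letters,
`[Δ_w, q · ∏ᵢ 1/(tᵢ − aᵢ)]`, exactly as inlined in `ArrangementNormalForm`. -/
def wordReps : Set KZ.FormalRep :=
  {y | ∃ (w : ℕ) (a : Fin w → ℚ) (q : ℚ) (s : KZ.IntegralRep w),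
    s.domain = {t | (∀ i, 0 < t i) ∧ (∀ i, t i < 1) ∧ StrictAnti t} ∧
    EqOn s.integrand (fun t => (q : ℝ) * ∏ i, 1 / (t i - (a i : ℝ))) s.domain ∧ y = KZ.of s}

/-- The hypothesis shape of the crux on a representation `r`: its domain is the open rational
polyhedral cell of `M` and its integrand is `P/∏ Lⱼ^{eⱼ}` on it. -/
def IsArrangementRep {n m m' : ℕ} (r : KZ.IntegralRep n) (M : Fin m' → (Fin n → ℚ) × ℚ)
    (L : Fin m → (Fin n → ℚ) × ℚ) (e : Fin m → ℕ) (p : MvPolynomial (Fin n) ℚ) : Prop :=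
  r.domain = {x | ∀ j, 0 < ∑ i, ((M j).1 i : ℝ) * x i + ((M j).2 : ℝ)} ∧
  EqOn r.integrand (fun x => MvPolynomial.aeval x p /
    ∏ j, (∑ i, ((L j).1 i : ℝ) * x i + ((L j).2 : ℝ)) ^ e j) r.domain

/-- Definitional unfolding of the crux through `wordReps` / `IsArrangementRep`. -/
theorem arrangementNormalForm_iff :
    ArrangementNormalForm ↔ ∀ (n m m' : ℕ) (r : KZ.IntegralRep n) (M : Fin m' → (Fin n → ℚ) × ℚ)
      (L : Fin m → (Fin n → ℚ) × ℚ) (e : Fin m → ℕ) (p : MvPolynomial (Fin n) ℚ),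
      IsArrangementRep r M L e p →
        ∃ c ∈ AddSubgroup.closure wordReps, KZ.of r - c ∈ KZ.relations := by
  unfold ArrangementNormalForm IsArrangementRep wordReps
  exact ⟨fun h n m m' r M L e p hr => h n m m' r M L e p hr.1 hr.2,
    fun h n m m' r M L e p h1 h2 => h n m m' r M L e p ⟨h1, h2⟩⟩

/-! ## §1 The `ℚ`-span of logarithms of positive rationals -/

/-- `logSpan`: the `ℚ`-subspace of `ℝ` spanned by `log ρ`, `ρ ∈ ℚ_{>0}` — the weight-one values. -/
def logSpan : Submodule ℚ ℝ := Submodule.span ℚ {x | ∃ ρ : ℚ, 0 < ρ ∧ x = Real.log ρ}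

theorem log_mem_logSpan {ρ : ℚ} (hρ : 0 < ρ) : Real.log ρ ∈ logSpan :=
  Submodule.subset_span ⟨ρ, hρ, rfl⟩

/-- Clearing denominators: every element of `logSpan` has a positive integer multiple which is the
logarithm of a positive rational. -/
theorem exists_nat_mul_eq_log_of_mem_logSpan {x : ℝ} (hx : x ∈ logSpan) :
    ∃ (N : ℕ) (ρ : ℚ), 0 < N ∧ 0 < ρ ∧ (N : ℝ) * x = Real.log ρ := by
  induction hx using Submodule.span_induction with
  | mem x hx =>
    obtain ⟨ρ, hρ, rfl⟩ := hx
    exact ⟨1, ρ, one_pos, hρ, by simp⟩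
  | zero => exact ⟨1, 1, one_pos, one_pos, by simp⟩
  | add x y _ _ hx hy =>
    obtain ⟨N₁, ρ₁, hN₁, hρ₁, h₁⟩ := hx
    obtain ⟨N₂, ρ₂, hN₂, hρ₂, h₂⟩ := hy
    refine ⟨N₁ * N₂, ρ₁ ^ N₂ * ρ₂ ^ N₁, Nat.mul_pos hN₁ hN₂,
      mul_pos (pow_pos hρ₁ _) (pow_pos hρ₂ _), ?_⟩
    have hρ₁' : (0 : ℝ) < ρ₁ := by exact_mod_cast hρ₁
    have hρ₂' : (0 : ℝ) < ρ₂ := by exact_mod_cast hρ₂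
    push_cast
    rw [Real.log_mul (pow_pos hρ₁' _).ne' (pow_pos hρ₂' _).ne', Real.log_pow, Real.log_pow,
      ← h₁, ← h₂]
    ring
  | smul q x _ hx =>
    obtain ⟨N, ρ, hN, hρ, h⟩ := hx
    refine ⟨N * q.den, ρ ^ q.num, Nat.mul_pos hN q.den_pos, zpow_pos hρ _, ?_⟩
    have hρ' : (0 : ℝ) < ρ := by exact_mod_cast hρ
    have hq : (q : ℝ) * q.den = q.num := by exact_mod_cast Rat.mul_den_eq_num q
    push_cast
    rw [Real.log_zpow, ← h, Rat.smul_def]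
    calc (N : ℝ) * (q.den : ℝ) * ((q : ℝ) * x) = ((q : ℝ) * q.den) * ((N : ℝ) * x) := by ring
      _ = (q.num : ℝ) * ((N : ℝ) * x) := by rw [hq]

/-- **`1 ∉ logSpan`** (Hermite–Lindemann): otherwise `N = log ρ` for some `N ≥ 1`, `ρ ∈ ℚ_{>0}`,
contradicting the irrationality of `log ρ` (`ρ ≠ 1`; the tree's proved
`Literature.Barriers.KontsevichZagierPeriods.irrational_log_ratCast`) or `N = 0` (`ρ = 1`). -/
theorem one_not_mem_logSpan : (1 : ℝ) ∉ logSpan := by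
  intro h
  obtain ⟨N, ρ, hN, hρ, h⟩ := exists_nat_mul_eq_log_of_mem_logSpan h
  rw [mul_one] at h
  by_cases hρ1 : ρ = 1
  · subst hρ1
    simp at h
    omega
  · exact Literature.Barriers.KontsevichZagierPeriods.irrational_log_ratCast ρ hρ hρ1
      ⟨N, by rw [← h]; simp⟩

/-- A non-zero rational is not in `logSpan`. -/
theorem ratCast_not_mem_logSpan {q : ℚ} (hq : q ≠ 0) : (q : ℝ) ∉ logSpan := by
  intro h
  have : (q⁻¹ : ℚ) • (q : ℝ) ∈ logSpan := logSpan.smul_mem _ h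
  rw [Rat.smul_def] at this
  push_cast at this
  rw [inv_mul_cancel₀ (by exact_mod_cast hq)] at this
  exact one_not_mem_logSpan this

/-! ## §2 Weight-one words: value and tightness -/

/-- The one-dimensional simplex is the unit interval pulled back along `funUnique`. -/
theorem simplex_one_eq_preimage :
    {t : Fin 1 → ℝ | (∀ i, 0 < t i) ∧ (∀ i, t i < 1) ∧ StrictAnti t} =
      (MeasurableEquiv.funUnique (Fin 1) ℝ) ⁻¹' Ioo 0 1 := by
  ext t
  have he : (MeasurableEquiv.funUnique (Fin 1) ℝ) t = t 0 := rfl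
  simp only [mem_setOf_eq, mem_preimage, mem_Ioo, Fin.forall_fin_one, he]
  exact ⟨fun h => ⟨h.1, h.2.1⟩, fun h => ⟨h.1, h.2, Subsingleton.strictAnti _⟩⟩

/-- Integrability of `(t − a)⁻¹` on `(0,1)` forces `a ∉ [0,1]`
(`intervalIntegrable_sub_inv_iff`). -/
theorem not_mem_uIcc_of_integrableOn_inv_sub {a : ℝ}
    (h : IntegrableOn (fun t : ℝ => (t - a)⁻¹) (Ioo 0 1)) : a ∉ uIcc (0 : ℝ) 1 := by
  have h' : IntervalIntegrable (fun t : ℝ => (t - a)⁻¹) volume 0 1 :=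
    (intervalIntegrable_iff_integrableOn_Ioo_of_le zero_le_one).mpr h
  rcases intervalIntegrable_sub_inv_iff.mp h' with h01 | hna
  · exact absurd h01 zero_ne_one
  · exact hna

/-- `∫₀¹ dt/(t − a) = log((1 − a)/(−a))` for `a ∉ [0,1]`. -/
theorem integral_inv_sub_unit {a : ℝ} (ha : a ∉ uIcc (0 : ℝ) 1) :
    ∫ t in Ioo (0 : ℝ) 1, (t - a)⁻¹ = Real.log ((1 - a) / (0 - a)) := by
  rw [← integral_Ioc_eq_integral_Ioo, ← intervalIntegral.integral_of_le zero_le_one,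
    intervalIntegral.integral_comp_sub_right (fun t => t⁻¹) a, integral_inv]
  intro h0
  apply ha
  rcases mem_uIcc.mp h0 with ⟨h1, h2⟩ | ⟨h1, h2⟩
  · exact mem_uIcc.mpr (Or.inl ⟨by linarith, by linarith⟩)
  · exact mem_uIcc.mpr (Or.inl ⟨by linarith, by linarith⟩)

/-- For `a ∉ [0,1]` the ratio `(1 − a)/(0 − a)` is positive. -/
theorem ratio_pos_of_not_mem_uIcc {a : ℚ} (ha : (a : ℝ) ∉ uIcc (0 : ℝ) 1) :
    0 < (1 - a) / (0 - a) := by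
  rcases lt_or_ge a 0 with h | h
  · exact div_pos (by linarith) (by linarith)
  · rcases le_or_gt a 1 with h' | h'
    · exact absurd (mem_uIcc.mpr (Or.inl ⟨by exact_mod_cast h, by exact_mod_cast h'⟩)) ha
    · exact div_pos_of_neg_of_neg (by linarith) (by linarith)

/-- **Value of a weight-one word.** A one-dimensional word representation
`[(0,1), q/(t − a)]` (as an `IntegralRep 1`, hence absolutely convergent) has value in `logSpan`:
either `q = 0`, or `a ∉ [0,1]` and the value is `q · log((1−a)/(−a))`, `(1−a)/(−a) ∈ ℚ_{>0}`. -/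
theorem value_mem_logSpan_of_wordRep_one (s : KZ.IntegralRep 1) (a : Fin 1 → ℚ) (q : ℚ)
    (hdom : s.domain = {t | (∀ i, 0 < t i) ∧ (∀ i, t i < 1) ∧ StrictAnti t})
    (hint : EqOn s.integrand (fun t => (q : ℝ) * ∏ i, 1 / (t i - (a i : ℝ))) s.domain) :
    s.value ∈ logSpan := by
  set e := MeasurableEquiv.funUnique (Fin 1) ℝ with he_def
  have he : ∀ t : Fin 1 → ℝ, e t = t 0 := fun t => rfl
  have hmp : MeasurePreserving e volume volume := volume_preserving_funUnique (Fin 1) ℝ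
  have hemb : MeasurableEmbedding e := e.measurableEmbedding
  have hdom' : s.domain = e ⁻¹' Ioo 0 1 := by rw [hdom]; exact simplex_one_eq_preimage
  have hmeas : MeasurableSet s.domain := KZ.IntegralRep.measurableSet_domain_holds s
  -- the integrand on the domain, as a function of `t 0`
  have hint' : EqOn s.integrand (fun t => (q : ℝ) * ((e t) - (a 0 : ℝ))⁻¹) s.domain := by
    intro t ht
    rw [hint ht]
    simp [he, one_div]
  -- value as a one-variable integral
  have hval : s.value = ∫ y in Ioo (0 : ℝ) 1, (q : ℝ) * (y - (a 0 : ℝ))⁻¹ := by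
    unfold KZ.IntegralRep.value
    rw [setIntegral_congr_fun hmeas hint', hdom']
    exact hmp.setIntegral_preimage_emb hemb (fun y => (q : ℝ) * (y - (a 0 : ℝ))⁻¹) (Ioo 0 1)
  by_cases hq : q = 0
  · rw [hval, hq]
    simp
  -- `q ≠ 0`: integrability transported to `ℝ` forces `a 0 ∉ [0,1]`
  have hI : IntegrableOn (fun t => (q : ℝ) * ((e t) - (a 0 : ℝ))⁻¹) s.domain :=
    s.integrableOn.congr_fun hint' hmeas
  have hI' : IntegrableOn (fun y : ℝ => (q : ℝ) * (y - (a 0 : ℝ))⁻¹) (Ioo 0 1) := by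
    rw [hdom'] at hI
    exact (hmp.integrableOn_comp_preimage hemb).mp hI
  have hI'' : IntegrableOn (fun y : ℝ => (y - (a 0 : ℝ))⁻¹) (Ioo 0 1) := by
    have h3 : IntegrableOn (fun y : ℝ => (q : ℝ)⁻¹ * ((q : ℝ) * (y - (a 0 : ℝ))⁻¹)) (Ioo 0 1) :=
      hI'.const_mul ((q : ℝ)⁻¹)
    refine IntegrableOn.congr_fun h3 (fun y _ => ?_) measurableSet_Ioo
    have hq' : (q : ℝ) ≠ 0 := by exact_mod_cast hq
    rw [← mul_assoc, inv_mul_cancel₀ hq', one_mul]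
  have ha : (a 0 : ℝ) ∉ uIcc (0 : ℝ) 1 := not_mem_uIcc_of_integrableOn_inv_sub hI''
  rw [hval, integral_const_mul, integral_inv_sub_unit ha]
  have hρ := ratio_pos_of_not_mem_uIcc ha
  have : Real.log ((1 - (a 0 : ℝ)) / (0 - (a 0 : ℝ))) = Real.log (((1 - a 0) / (0 - a 0) : ℚ) : ℝ) := by
    push_cast; ring_nf
  rw [this, ← Rat.smul_def]
  exact logSpan.smul_mem q (log_mem_logSpan hρ)

/-- **TIGHTNESS of the target class (weight one).** A weight-one word representation
`[(0,1), q/(t − a)]` with `q ≠ 0` has its letter outside `[0,1]`: letters `0`, `1` and interior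
letters give divergent, hence non-existent, representations (`IntegralRep` demands absolute
convergence). Provers must land exactly on letters `a < 0` or `a > 1` in weight one. -/
theorem letter_not_mem_Icc_of_wordRep_one (s : KZ.IntegralRep 1) (a : Fin 1 → ℚ) (q : ℚ)
    (hdom : s.domain = {t | (∀ i, 0 < t i) ∧ (∀ i, t i < 1) ∧ StrictAnti t})
    (hint : EqOn s.integrand (fun t => (q : ℝ) * ∏ i, 1 / (t i - (a i : ℝ))) s.domain)
    (hq : q ≠ 0) : (a 0 : ℝ) ∉ Icc (0 : ℝ) 1 := by
  set e := MeasurableEquiv.funUnique (Fin 1) ℝ with he_def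
  have he : ∀ t : Fin 1 → ℝ, e t = t 0 := fun t => rfl
  have hmp : MeasurePreserving e volume volume := volume_preserving_funUnique (Fin 1) ℝ
  have hemb : MeasurableEmbedding e := e.measurableEmbedding
  have hdom' : s.domain = e ⁻¹' Ioo 0 1 := by rw [hdom]; exact simplex_one_eq_preimage
  have hmeas : MeasurableSet s.domain := KZ.IntegralRep.measurableSet_domain_holds s
  have hint' : EqOn s.integrand (fun t => (q : ℝ) * ((e t) - (a 0 : ℝ))⁻¹) s.domain := by
    intro t ht
    rw [hint ht]
    simp [he, one_div]
  have hI : IntegrableOn (fun t => (q : ℝ) * ((e t) - (a 0 : ℝ))⁻¹) s.domain :=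
    s.integrableOn.congr_fun hint' hmeas
  have hI' : IntegrableOn (fun y : ℝ => (q : ℝ) * (y - (a 0 : ℝ))⁻¹) (Ioo 0 1) := by
    rw [hdom'] at hI
    exact (hmp.integrableOn_comp_preimage hemb).mp hI
  have hI'' : IntegrableOn (fun y : ℝ => (y - (a 0 : ℝ))⁻¹) (Ioo 0 1) := by
    have h3 : IntegrableOn (fun y : ℝ => (q : ℝ)⁻¹ * ((q : ℝ) * (y - (a 0 : ℝ))⁻¹)) (Ioo 0 1) :=
      hI'.const_mul ((q : ℝ)⁻¹)
    refine IntegrableOn.congr_fun h3 (fun y _ => ?_) measurableSet_Ioo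
    have hq' : (q : ℝ) ≠ 0 := by exact_mod_cast hq
    rw [← mul_assoc, inv_mul_cancel₀ hq', one_mul]
  have ha : (a 0 : ℝ) ∉ uIcc (0 : ℝ) 1 := not_mem_uIcc_of_integrableOn_inv_sub hI''
  rwa [uIcc_of_le zero_le_one] at ha


/-! ## §3 Dimension-filtered evaluation: every move except Newton–Leibniz is homogeneous -/

/-- Evaluation restricted to the generators of dimension `k` (others sent to `0`). -/
def evalDim (k : ℕ) : KZ.FormalRep →+ ℝ :=
  FreeAbelianGroup.lift fun x => if x.1 = k then x.2.value else 0

@[simp] theorem evalDim_of (k : ℕ) {n : ℕ} (r : KZ.IntegralRep n) :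
    evalDim k (KZ.of r) = if n = k then r.value else 0 :=
  FreeAbelianGroup.lift_apply_of _ _

/-- The relations of the calculus WITHOUT rule (3): the subgroup generated by domain additivity
(1a), integrand additivity (1b) and change of variables (2) only. -/
def relationsWithoutNL : AddSubgroup KZ.FormalRep :=
  AddSubgroup.closure (KZ.domainAddRel ∪ KZ.integrandAddRel ∪ KZ.changeOfVariablesRel)

theorem relationsWithoutNL_le_relations : relationsWithoutNL ≤ KZ.relations :=
  AddSubgroup.closure_mono subset_union_left

/-- **Dimension is a move invariant without rule (3).** Each generator of (1a), (1b), (2) lives in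
a single dimension, so the dimension-`k` evaluation vanishes on it (by soundness in dimension `k`,
trivially elsewhere); hence `relationsWithoutNL ≤ ker (evalDim k)` for every `k`. -/
theorem relationsWithoutNL_le_ker_evalDim (k : ℕ) : relationsWithoutNL ≤ (evalDim k).ker := by
  refine (AddSubgroup.closure_le _).mpr ?_
  rintro c ((hc | hc) | hc)
  · have h0 := KZ.eval_eq_zero_of_mem_domainAddRel_holds hc
    obtain ⟨n, r, r₁, r₂, -, -, -, -, rfl⟩ := hc
    simp only [map_sub, KZ.eval_of] at h0
    simp only [SetLike.mem_coe, AddMonoidHom.mem_ker, map_sub, evalDim_of]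
    by_cases h : n = k
    · simp [h] at *
      linarith
    · simp [h]
  · have h0 := KZ.eval_eq_zero_of_mem_integrandAddRel_holds hc
    obtain ⟨n, r, r₁, r₂, -, -, -, rfl⟩ := hc
    simp only [map_sub, KZ.eval_of] at h0
    simp only [SetLike.mem_coe, AddMonoidHom.mem_ker, map_sub, evalDim_of]
    by_cases h : n = k
    · simp [h] at *
      linarith
    · simp [h]
  · have h0 := KZ.eval_eq_zero_of_mem_changeOfVariablesRel_holds hc
    obtain ⟨n, r, r', Φ, Φ', -, -, -, -, -, rfl⟩ := hc
    simp only [map_sub, KZ.eval_of] at h0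
    simp only [SetLike.mem_coe, AddMonoidHom.mem_ker, map_sub, evalDim_of]
    by_cases h : n = k
    · simp [h] at *
      linarith
    · simp [h]

/-! ## §4 LOAD-BEARING: the crux is false without the Newton–Leibniz move -/

/-- Every open rational polyhedral cell is `ℚ`-semialgebraic (a finite intersection of strict
positivity sets of degree-one polynomials over `ℚ`). Reusable by provers. -/
theorem isSemialgebraic_cell {n m' : ℕ} (M : Fin m' → (Fin n → ℚ) × ℚ) :
    Literature.ModelTheory.ExponentialFields.IsSemialgebraic ℚ
      {x : Fin n → ℝ | ∀ j, 0 < ∑ i, ((M j).1 i : ℝ) * x i + ((M j).2 : ℝ)} := by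
  have : {x : Fin n → ℝ | ∀ j, 0 < ∑ i, ((M j).1 i : ℝ) * x i + ((M j).2 : ℝ)} =
      ⋂ j ∈ (Finset.univ : Finset (Fin m')), {x | 0 < MvPolynomial.aeval x
        ((∑ i, MvPolynomial.C ((M j).1 i) * MvPolynomial.X i + MvPolynomial.C (M j).2 :
          MvPolynomial (Fin n) ℚ))} := by
    ext x
    simp [map_sum]
  rw [this]
  exact Literature.ModelTheory.ExponentialFields.IsSemialgebraic.biInter _ _ fun j _ =>
    Literature.ModelTheory.ExponentialFields.isSemialgebraic_setOf_eval_pos (k := ℚ) _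

/-- Rows of the unit interval as a cell in `ℝ¹`: `x₀ > 0` and `−x₀ + 1 > 0`. -/
def unitCell : Fin 2 → (Fin 1 → ℚ) × ℚ := ![(fun _ => 1, 0), (fun _ => -1, 1)]

/-- The cell of `unitCell` is `(0,1)` pulled back along `funUnique`. -/
theorem cell_unitCell_eq :
    {x : Fin 1 → ℝ | ∀ j, 0 < ∑ i, ((unitCell j).1 i : ℝ) * x i + ((unitCell j).2 : ℝ)} =
      (MeasurableEquiv.funUnique (Fin 1) ℝ) ⁻¹' Ioo 0 1 := by
  ext x
  have he : (MeasurableEquiv.funUnique (Fin 1) ℝ) x = x 0 := rfl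
  simp only [unitCell, mem_setOf_eq, Fin.forall_fin_two, Fin.sum_univ_one, Matrix.cons_val_zero,
    Matrix.cons_val_one, mem_preimage, he, mem_Ioo]
  push_cast
  constructor
  · rintro ⟨h1, h2⟩; exact ⟨by linarith, by linarith⟩
  · rintro ⟨h1, h2⟩; exact ⟨by linarith, by linarith⟩

theorem volume_cell_unitCell :
    volume {x : Fin 1 → ℝ | ∀ j, 0 < ∑ i, ((unitCell j).1 i : ℝ) * x i + ((unitCell j).2 : ℝ)} = 1 := by
  rw [cell_unitCell_eq]
  have h := (volume_preserving_funUnique (Fin 1) ℝ).measure_preimage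
    (s := Ioo (0 : ℝ) 1) measurableSet_Ioo.nullMeasurableSet
  simp only [Real.volume_Ioo, sub_zero, ENNReal.ofReal_one] at h
  exact h

/-- **The witness** `∫_{(0,1)} 1 dx = 1` as an arrangement representation: cell `unitCell`,
`P = 1`, no linear forms (`m = 0`). -/
def unitRep : KZ.IntegralRep 1 :=
  KZ.IntegralRep.ofRational
    {x | ∀ j, 0 < ∑ i, ((unitCell j).1 i : ℝ) * x i + ((unitCell j).2 : ℝ)} 1 1
    (isSemialgebraic_cell unitCell) (fun _ _ => by simp) (by
      simp only [map_one, div_one]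
      exact integrableOn_const (by rw [volume_cell_unitCell]; simp))

theorem unitRep_domain :
    unitRep.domain = {x | ∀ j, 0 < ∑ i, ((unitCell j).1 i : ℝ) * x i + ((unitCell j).2 : ℝ)} :=
  rfl

theorem unitRep_integrand : unitRep.integrand = fun _ => 1 := by
  ext x; simp [unitRep]

/-- `unitRep` satisfies the integrand hypothesis of the crux with `P = 1`, `m = 0`. -/
theorem unitRep_eqOn :
    EqOn unitRep.integrand (fun x => MvPolynomial.aeval x (1 : MvPolynomial (Fin 1) ℚ) /
      ∏ j : Fin 0, (∑ i, (((Fin.elim0 j : (Fin 1 → ℚ) × ℚ)).1 i : ℝ) * x i +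
        (((Fin.elim0 j : (Fin 1 → ℚ) × ℚ)).2 : ℝ)) ^ (Fin.elim0 j : ℕ)) unitRep.domain := by
  intro x _
  simp [unitRep_integrand]

theorem unitRep_value : unitRep.value = 1 := by
  unfold KZ.IntegralRep.value
  rw [unitRep_integrand]
  simp only [setIntegral_const, smul_eq_mul, mul_one, measureReal_def, unitRep_domain,
    volume_cell_unitCell, ENNReal.toReal_one]

/-- The crux with `KZ.relations` replaced by `relationsWithoutNL` (rules (1a), (1b), (2) only). -/
def ArrangementNormalFormWithoutNewtonLeibniz : Prop :=
  ∀ (n m m' : ℕ) (r : KZ.IntegralRep n) (M : Fin m' → (Fin n → ℚ) × ℚ)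
    (L : Fin m → (Fin n → ℚ) × ℚ) (e : Fin m → ℕ) (p : MvPolynomial (Fin n) ℚ),
    r.domain = {x | ∀ j, 0 < ∑ i, ((M j).1 i : ℝ) * x i + ((M j).2 : ℝ)} →
    EqOn r.integrand (fun x => MvPolynomial.aeval x p /
      ∏ j, (∑ i, ((L j).1 i : ℝ) * x i + ((L j).2 : ℝ)) ^ e j) r.domain →
    ∃ c ∈ AddSubgroup.closure wordReps, KZ.of r - c ∈ relationsWithoutNL

/-- The dimension-one evaluation of the word closure lies in `logSpan` (weight-one words have
values `q·log ρ`, all other words are invisible to `evalDim 1`). -/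
theorem closure_wordReps_le_comap_evalDim_one :
    AddSubgroup.closure wordReps ≤ logSpan.toAddSubgroup.comap (evalDim 1) := by
  rw [AddSubgroup.closure_le]
  rintro y ⟨w, a, q, s, hdom, hint, rfl⟩
  simp only [SetLike.mem_coe, AddSubgroup.mem_comap, evalDim_of, Submodule.mem_toAddSubgroup]
  by_cases hw : w = 1
  · subst hw
    rw [if_pos rfl]
    exact value_mem_logSpan_of_wordRep_one s a q hdom hint
  · rw [if_neg hw]
    exact zero_mem _

/-- **LOAD-BEARING (rule 3).** `ArrangementNormalForm` is FALSE for the calculus without the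
Newton–Leibniz move: rules (1a), (1b), (2) are dimension-homogeneous, so `evalDim 1` is an invariant
of `relationsWithoutNL`; for the witness `∫₀¹ 1 dx` it gives `1 = evalDim 1 (c) ∈ logSpan`
(weight-one words evaluate to `q·log ρ`), contradicting Hermite–Lindemann (`1 ∉ logSpan`).
Any proof of the crux must use rule (3) (with an ALGEBRAIC primitive) to change dimension. -/
theorem arrangementNormalForm_false_without_newtonLeibniz :
    ¬ ArrangementNormalFormWithoutNewtonLeibniz := by
  intro H
  obtain ⟨c, hc, hrel⟩ := H 1 0 2 unitRep unitCell Fin.elim0 Fin.elim0 1 rfl unitRep_eqOn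
  have h1 : evalDim 1 (KZ.of unitRep - c) = 0 := relationsWithoutNL_le_ker_evalDim 1 hrel
  rw [map_sub, evalDim_of, if_pos rfl, unitRep_value, sub_eq_zero] at h1
  have hc' := closure_wordReps_le_comap_evalDim_one hc
  rw [AddSubgroup.mem_comap, ← h1] at hc'
  exact one_not_mem_logSpan hc'

/-! ## §5 STRENGTHENING refuted: no pure-weight normal form -/

/-- Word representations of a FIXED weight `w`. -/
def wordRepsOfWeight (w : ℕ) : Set KZ.FormalRep :=
  {y | ∃ (a : Fin w → ℚ) (q : ℚ) (s : KZ.IntegralRep w),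
    s.domain = {t | (∀ i, 0 < t i) ∧ (∀ i, t i < 1) ∧ StrictAnti t} ∧
    EqOn s.integrand (fun t => (q : ℝ) * ∏ i, 1 / (t i - (a i : ℝ))) s.domain ∧ y = KZ.of s}

theorem wordRepsOfWeight_subset (w : ℕ) : wordRepsOfWeight w ⊆ wordReps := by
  rintro y ⟨a, q, s, h1, h2, rfl⟩
  exact ⟨w, a, q, s, h1, h2, rfl⟩

/-- The natural strengthening "an `n`-dimensional arrangement integral has a normal form in words
of weight exactly `n`" (pure weight, no weight drop). -/
def SameWeightNormalForm : Prop :=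
  ∀ (n m m' : ℕ) (r : KZ.IntegralRep n) (M : Fin m' → (Fin n → ℚ) × ℚ)
    (L : Fin m → (Fin n → ℚ) × ℚ) (e : Fin m → ℕ) (p : MvPolynomial (Fin n) ℚ),
    r.domain = {x | ∀ j, 0 < ∑ i, ((M j).1 i : ℝ) * x i + ((M j).2 : ℝ)} →
    EqOn r.integrand (fun x => MvPolynomial.aeval x p /
      ∏ j, (∑ i, ((L j).1 i : ℝ) * x i + ((L j).2 : ℝ)) ^ e j) r.domain →
    ∃ c ∈ AddSubgroup.closure (wordRepsOfWeight n), KZ.of r - c ∈ KZ.relations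

/-- **No pure-weight normal form.** `SameWeightNormalForm` is false: `∫₀¹ 1 dx = 1` would be the
value of a `ℤ`-combination of weight-one words, i.e. `1 ∈ logSpan`, contradicting
Hermite–Lindemann; here the FULL calculus is used, through its soundness
`KZ.relations_le_ker_eval_holds`. The normal form of an `n`-dimensional arrangement integral must
mix the weights `0, …, n` (e.g. `∫₀¹ dx/(x+1)² = 1/2`, `∫∫_{(0,1)²} dxdy/(1+x+y) = 3 log 3 − 4 log 2`). -/
theorem not_sameWeightNormalForm : ¬ SameWeightNormalForm := by
  intro H
  obtain ⟨c, hc, hrel⟩ := H 1 0 2 unitRep unitCell Fin.elim0 Fin.elim0 1 rfl unitRep_eqOn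
  have h1 : KZ.eval (KZ.of unitRep - c) = 0 :=
    (AddMonoidHom.mem_ker).1 (KZ.relations_le_ker_eval_holds hrel)
  rw [map_sub, KZ.eval_of, unitRep_value, sub_eq_zero] at h1
  have hle : AddSubgroup.closure (wordRepsOfWeight 1) ≤ logSpan.toAddSubgroup.comap KZ.eval := by
    rw [AddSubgroup.closure_le]
    rintro y ⟨a, q, s, hdom, hint, rfl⟩
    simp only [SetLike.mem_coe, AddSubgroup.mem_comap, KZ.eval_of, Submodule.mem_toAddSubgroup]
    exact value_mem_logSpan_of_wordRep_one s a q hdom hint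
  have hc' := hle hc
  rw [AddSubgroup.mem_comap, ← h1] at hc'
  exact one_not_mem_logSpan hc'

/-! ## §6 DEGENERATE INSTANCES HOLD (junk does not refute the crux) -/

/-- A representation with NULL domain is a relation: domain additivity with `σ = σ ∪ σ`. In
particular empty cells and measure-zero modifications of integrands are invisible to the calculus. -/
theorem of_mem_relations_of_volume_eq_zero {n : ℕ} (r : KZ.IntegralRep n)
    (h : volume r.domain = 0) : KZ.of r ∈ KZ.relations := by
  have hmem : KZ.of r - KZ.of r - KZ.of r ∈ KZ.relations :=
    KZ.domainAddRel_subset_relations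
      ⟨n, r, r, r, by simp, by simpa using h, eqOn_refl _ _, eqOn_refl _ _, rfl⟩
  have : KZ.of r - KZ.of r - KZ.of r = -KZ.of r := by abel
  rw [this, neg_mem_iff] at hmem
  exact hmem

theorem of_mem_relations_of_domain_eq_empty {n : ℕ} (r : KZ.IntegralRep n)
    (h : r.domain = ∅) : KZ.of r ∈ KZ.relations :=
  of_mem_relations_of_volume_eq_zero r (by rw [h]; exact measure_empty)

/-- **The crux holds in dimension `0`.** A `0`-dimensional cell is either all of `ℝ⁰` (then `r`
itself is the weight-zero word with `q = P(·)/∏ mⱼ^{eⱼ} ∈ ℚ`) or empty (then `[r]` is a relation). -/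
theorem arrangementNormalForm_dim_zero (m m' : ℕ) (r : KZ.IntegralRep 0)
    (M : Fin m' → (Fin 0 → ℚ) × ℚ) (L : Fin m → (Fin 0 → ℚ) × ℚ) (e : Fin m → ℕ)
    (p : MvPolynomial (Fin 0) ℚ)
    (hdom : r.domain = {x | ∀ j, 0 < ∑ i, ((M j).1 i : ℝ) * x i + ((M j).2 : ℝ)})
    (hint : EqOn r.integrand (fun x => MvPolynomial.aeval x p /
      ∏ j, (∑ i, ((L j).1 i : ℝ) * x i + ((L j).2 : ℝ)) ^ e j) r.domain) :
    ∃ c ∈ AddSubgroup.closure wordReps, KZ.of r - c ∈ KZ.relations := by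
  by_cases hM : ∀ j, (0 : ℚ) < (M j).2
  · refine ⟨KZ.of r, AddSubgroup.subset_closure ?_, by simp⟩
    refine ⟨0, Fin.elim0, p.coeff 0 / ∏ j, (L j).2 ^ e j, r, ?_, ?_, rfl⟩
    · rw [hdom]
      ext x
      simp only [Finset.univ_eq_empty, Finset.sum_empty, zero_add, mem_setOf_eq, IsEmpty.forall_iff,
        true_and]
      exact ⟨fun _ => Subsingleton.strictAnti _, fun _ j => by exact_mod_cast hM j⟩
    · intro x hx
      rw [hint hx]
      have hp : MvPolynomial.aeval x p = ((p.coeff 0 : ℚ) : ℝ) := by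
        conv_lhs => rw [p.eq_C_of_isEmpty]
        simp
      simp only [hp, Finset.univ_eq_empty, Finset.sum_empty, zero_add, Finset.prod_empty, mul_one]
      push_cast
      rfl
  · push Not at hM
    obtain ⟨j, hj⟩ := hM
    refine ⟨0, zero_mem _, ?_⟩
    rw [sub_zero]
    apply of_mem_relations_of_domain_eq_empty
    rw [hdom]
    ext x
    simp only [Finset.univ_eq_empty, Finset.sum_empty, zero_add, mem_setOf_eq, mem_empty_iff_false,
      iff_false, not_forall, not_lt]
    exact ⟨j, by exact_mod_cast hj⟩

/-! ## §7 NEAR-MISSES (open; recorded with the obstruction) -/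

/-- NEAR-MISS (dropping the CELL hypothesis). With an arbitrary `ℚ`-semialgebraic domain the
normal form fails at VALUE level iff some such value leaves
`H := ℚ-span {convergent ∫_{Δ_w} ∏ dtᵢ/(tᵢ − aᵢ), aᵢ ∈ ℚ}`; the witness `[unit disc, 1]` has value
`π`, and `π ∉ H` is expected (no `F_∞`-invariant real period of odd Tate weight; `H` is spanned by
real multiple polylogarithms at rational arguments) but is OPEN transcendence — it does not follow
from Hermite–Lindemann/Baker since `H` contains `ζ(3)`, `Li₂(1/3)`, … . No move-level invariant
finer than the value is known (that would be kill criterion (1) of the route, i.e. `¬KZ`).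
Tried: dimension filter (killed by rule 3), augmentation (killed by additivity), o-minimal Euler
characteristic of domains (not additive under integrand additivity). -/
theorem arrangementNormalForm_false_without_cell :
    ¬ ∀ (n m : ℕ) (r : KZ.IntegralRep n) (L : Fin m → (Fin n → ℚ) × ℚ) (e : Fin m → ℕ)
        (p : MvPolynomial (Fin n) ℚ),
      EqOn r.integrand (fun x => MvPolynomial.aeval x p /
        ∏ j, (∑ i, ((L j).1 i : ℝ) * x i + ((L j).2 : ℝ)) ^ e j) r.domain →
      ∃ c ∈ AddSubgroup.closure wordReps, KZ.of r - c ∈ KZ.relations := by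
  sorry

/-- NEAR-MISS (dropping the LINEAR-FORM hypothesis). On the cell `(0,1)` with an arbitrary
rational integrand the witness `[(0,1), 4/(1+x²)]` has value `π`; refuting the variant reduces
again to the open `π ∉ H` (see `arrangementNormalForm_false_without_cell`). -/
theorem arrangementNormalForm_false_without_linearForms :
    ¬ ∀ (n m' : ℕ) (r : KZ.IntegralRep n) (M : Fin m' → (Fin n → ℚ) × ℚ)
        (p q : MvPolynomial (Fin n) ℚ),
      r.domain = {x | ∀ j, 0 < ∑ i, ((M j).1 i : ℝ) * x i + ((M j).2 : ℝ)} →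
      EqOn r.integrand (fun x => MvPolynomial.aeval x p / MvPolynomial.aeval x q) r.domain →
      ∃ c ∈ AddSubgroup.closure wordReps, KZ.of r - c ∈ KZ.relations := by
  sorry


/-! ## §8 The `∞ − ∞` obstruction certified: partial-fraction pieces are not representations -/

/-- **The naive first move is illegal (certified `∞ − ∞`).** For the first non-trivial test
`∫∫_{(0,1)²} dx dy/((1+x+y)(1+2x+y))`, integrand additivity in `y` would use the pieces
`1/(x(1+x+y)) − 1/(x(1+2x+y))`; but `1/(x(1+x+y))` is NOT absolutely integrable on the open unit
square (it dominates `1/(3x)`, whose marginal `x⁻¹` is not integrable at `0`,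
`intervalIntegrable_inv_iff`), so these pieces are not `IntegralRep`s and rule (1b) does not apply
to them. A move chain must first resolve the corner `x = 0` (blow-up = rule 2 on sub-cells + 1a),
or pair the pieces inside ONE convergent representation in more variables (unfolding). -/
theorem not_integrableOn_partialFractionPiece :
    ¬ IntegrableOn (fun v : Fin 2 → ℝ => 1 / (v 0 * (1 + v 0 + v 1)))
      (Set.pi univ fun _ : Fin 2 => Ioo (0 : ℝ) 1) := by
  intro h
  set sq : Set (Fin 2 → ℝ) := Set.pi univ fun _ : Fin 2 => Ioo (0 : ℝ) 1 with hsq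
  have hmeas : MeasurableSet sq := MeasurableSet.univ_pi fun _ => measurableSet_Ioo
  -- (1) the minorant `(v 0)⁻¹ ≤ 3 / (v 0 (1 + v 0 + v 1))` is integrable on the square
  have h3 : IntegrableOn (fun v : Fin 2 → ℝ => (3 : ℝ) * (1 / (v 0 * (1 + v 0 + v 1)))) sq :=
    h.const_mul 3
  have hinv : IntegrableOn (fun v : Fin 2 → ℝ => (v 0)⁻¹) sq := by
    refine Integrable.mono' h3 (measurable_pi_apply 0).inv.aestronglyMeasurable ?_
    rw [ae_restrict_iff' hmeas]
    refine Filter.Eventually.of_forall fun v hv => ?_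
    have hv' := Set.mem_univ_pi.mp hv
    have h0 : 0 < v 0 := (hv' 0).1
    have h0' : v 0 < 1 := (hv' 0).2
    have h1 : 0 < v 1 := (hv' 1).1
    have h1' : v 1 < 1 := (hv' 1).2
    have hD : 0 < v 0 * (1 + v 0 + v 1) := by positivity
    rw [Real.norm_eq_abs, abs_of_pos (inv_pos.mpr h0), mul_one_div, le_div_iff₀ hD, ← mul_assoc,
      inv_mul_cancel₀ h0.ne', one_mul]
    linarith
  -- (2) the restricted volume on the square is a product of probability measures; take the marginal
  have hvol : (volume : Measure (Fin 2 → ℝ)).restrict sq =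
      Measure.pi fun _ : Fin 2 => (volume : Measure ℝ).restrict (Ioo 0 1) := by
    rw [hsq, MeasureTheory.volume_pi, Measure.restrict_pi_pi]
  haveI : IsProbabilityMeasure ((volume : Measure ℝ).restrict (Ioo 0 1)) := ⟨by simp⟩
  have hmp : MeasurePreserving (Function.eval (0 : Fin 2))
      (Measure.pi fun _ : Fin 2 => (volume : Measure ℝ).restrict (Ioo 0 1))
      ((volume : Measure ℝ).restrict (Ioo 0 1)) :=
    measurePreserving_eval (fun _ : Fin 2 => (volume : Measure ℝ).restrict (Ioo 0 1)) 0
  have hI : Integrable (fun x : ℝ => x⁻¹) ((volume : Measure ℝ).restrict (Ioo 0 1)) := by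
    rw [← hmp.integrable_comp measurable_inv.aestronglyMeasurable, ← hvol]
    exact hinv
  -- (3) contradiction: `x⁻¹` is not integrable at `0`
  have hII : IntervalIntegrable (fun x : ℝ => x⁻¹) volume 0 1 :=
    (intervalIntegrable_iff_integrableOn_Ioo_of_le zero_le_one).mpr hI
  rcases intervalIntegrable_inv_iff.mp hII with h01 | h0
  · exact zero_ne_one h01
  · exact h0 left_mem_uIcc


/-! ## §9 POSITIVE BY-PRODUCT: admissible rational words EXIST as representations

To use the conclusion `∃ c ∈ closure wordReps` a prover must construct word representations,
i.e. prove absolute convergence; `WordReps.exists_wordRep` does it for every admissible rational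
word (no interior letters, `a₀ ≠ 1`, `a_{w−1} ≠ 0`) by domination with an admissible MZV pattern
(`KZ.integrableOn_prod_mzvForm`). Sorry-free; also attached separately as `WordReps.lean`. -/

namespace WordReps


open MeasureTheory Set
open Literature.NumberTheory.Transcendental

/-- On `(0,1)` both MZV forms are `≥ 1`. [folklore] -/
theorem one_le_mzvForm (b : Bool) {x : ℝ} (h0 : 0 < x) (h1 : x < 1) : 1 ≤ KZ.mzvForm b x := by
  cases b
  · simp only [KZ.mzvForm, Bool.false_eq_true, ↓reduceIte]
    rw [le_div_iff₀ h0]; linarith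
  · simp only [KZ.mzvForm, ↓reduceIte]
    rw [le_div_iff₀ (by linarith)]; linarith

/-- The constant bounding an outside-letter factor: `C a = 1` for `a ∈ {0,1}`, else
`1 / min(|a|, |a − 1|)`. [folklore] -/
def letterBound (a : ℚ) : ℝ := if a = 0 ∨ a = 1 then 1 else 1 / min |(a : ℝ)| |(a : ℝ) - 1|

theorem letterBound_pos (a : ℚ) : 0 < letterBound a := by
  unfold letterBound
  split_ifs with h
  · exact one_pos
  · push Not at h
    have h0 : (a : ℝ) ≠ 0 := by exact_mod_cast h.1
    have h1 : (a : ℝ) - 1 ≠ 0 := sub_ne_zero.mpr (by exact_mod_cast h.2)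
    exact one_div_pos.mpr (lt_min (abs_pos.mpr h0) (abs_pos.mpr h1))

/-- The dominating MZV pattern of a rational word (as a function on `ℕ`): letter `1 ↦ ω₁`,
letter `0 ↦ ω₀`, outside letters `↦ ω₁` in the last position and `ω₀` elsewhere. [folklore] -/
def pattern {w : ℕ} (a : Fin w → ℚ) (k : ℕ) : Bool :=
  if h : k < w then
    (if a ⟨k, h⟩ = 1 then true else if a ⟨k, h⟩ = 0 then false else decide (k = w - 1))
  else false

/-- **Factorwise domination.** For `t ∈ (0,1)` and a letter `a ∉ (0,1)`:
`|1/(t − a)| ≤ C_a · ω_{pattern}(t)`. [folklore] -/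
theorem abs_inv_sub_le {w : ℕ} (a : Fin w → ℚ) (hout : ∀ i, a i ≤ 0 ∨ 1 ≤ a i) (i : Fin w)
    {x : ℝ} (h0 : 0 < x) (h1 : x < 1) :
    |1 / (x - (a i : ℝ))| ≤ letterBound (a i) * KZ.mzvForm (pattern a i) x := by
  have hpat : pattern a i = (if a i = 1 then true else if a i = 0 then false
      else decide ((i : ℕ) = w - 1)) := by
    simp [pattern, i.isLt]
  by_cases ha1 : a i = 1
  · have : pattern a i = true := by rw [hpat]; simp [ha1]
    rw [this, letterBound, if_pos (Or.inr ha1), one_mul, ha1]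
    simp only [KZ.mzvForm, ↓reduceIte, Rat.cast_one]
    rw [abs_of_neg (by rw [one_div]; exact inv_lt_zero.mpr (by linarith)), one_div, one_div,
      ← inv_neg, neg_sub]
  by_cases ha0 : a i = 0
  · have : pattern a i = false := by rw [hpat]; simp [ha0]
    rw [this, letterBound, if_pos (Or.inl ha0), one_mul, ha0]
    simp only [KZ.mzvForm, Bool.false_eq_true, ↓reduceIte, Rat.cast_zero, sub_zero]
    rw [abs_of_pos (by positivity)]
  -- outside letter: bounded factor times a form `≥ 1`
  have hC : letterBound (a i) = 1 / min |(a i : ℝ)| |(a i : ℝ) - 1| := by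
    rw [letterBound, if_neg (by tauto)]
  have hδ : 0 < min |(a i : ℝ)| |(a i : ℝ) - 1| := by
    have := letterBound_pos (a i); rwa [hC, one_div_pos] at this
  have hbound : |1 / (x - (a i : ℝ))| ≤ letterBound (a i) := by
    rw [hC, abs_one_div, one_div_le_one_div (abs_pos.mpr ?_) hδ]
    · rcases hout i with h | h
      · have h' : (a i : ℝ) < 0 := by exact_mod_cast lt_of_le_of_ne h ha0
        calc min |(a i : ℝ)| |(a i : ℝ) - 1| ≤ |(a i : ℝ)| := min_le_left _ _
          _ = -(a i : ℝ) := abs_of_neg h'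
          _ ≤ |x - (a i : ℝ)| := by rw [abs_of_pos (by linarith)]; linarith
      · have h' : (1 : ℝ) < a i := by exact_mod_cast lt_of_le_of_ne h (Ne.symm ha1)
        calc min |(a i : ℝ)| |(a i : ℝ) - 1| ≤ |(a i : ℝ) - 1| := min_le_right _ _
          _ = (a i : ℝ) - 1 := abs_of_pos (by linarith)
          _ ≤ |x - (a i : ℝ)| := by rw [abs_of_neg (by linarith)]; linarith
    · intro hx
      rcases hout i with h | h
      · have h' : (a i : ℝ) ≤ 0 := by exact_mod_cast h
        linarith [sub_eq_zero.mp hx]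
      · have h' : (1 : ℝ) ≤ a i := by exact_mod_cast h
        linarith [sub_eq_zero.mp hx]
  calc |1 / (x - (a i : ℝ))| ≤ letterBound (a i) := hbound
    _ = letterBound (a i) * 1 := (mul_one _).symm
    _ ≤ letterBound (a i) * KZ.mzvForm (pattern a i) x :=
        mul_le_mul_of_nonneg_left (one_le_mzvForm _ h0 h1) (letterBound_pos _).le

/-- The word integrand is continuous on the open ordered simplex (no letter is hit).
[folklore] -/
theorem continuousOn_wordIntegrand {w : ℕ} (a : Fin w → ℚ) (q : ℚ)
    (hout : ∀ i, a i ≤ 0 ∨ 1 ≤ a i) :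
    ContinuousOn (fun t : Fin w → ℝ => (q : ℝ) * ∏ i, 1 / (t i - (a i : ℝ)))
      (KZ.openOrderedSimplex w) := by
  refine continuousOn_const.mul (continuousOn_finsetProd _ fun i _ => ?_)
  refine ContinuousOn.div continuousOn_const
    (((continuous_apply i).continuousOn).sub continuousOn_const) fun t ht => ?_
  obtain ⟨h0, h1, -⟩ := ht
  intro hx
  rcases hout i with h | h
  · have h' : (a i : ℝ) ≤ 0 := by exact_mod_cast h
    linarith [sub_eq_zero.mp hx, h0 i]
  · have h' : (1 : ℝ) ≤ a i := by exact_mod_cast h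
    linarith [sub_eq_zero.mp hx, h1 i]

/-- **Admissible rational words converge absolutely.** For letters `aᵢ ∉ (0,1)` with `a₀ ≠ 1`
and `a_{w−1} ≠ 0`, the word integrand `q · ∏ᵢ 1/(tᵢ − aᵢ)` is integrable on the open ordered
simplex `{1 > t₀ > ⋯ > t_{w−1} > 0}` (domination by the admissible MZV pattern `pattern a`,
`KZ.integrableOn_prod_mzvForm`; weight `≤ 1` by boundedness / finiteness). [folklore] -/
theorem integrableOn_wordIntegrand {w : ℕ} (a : Fin w → ℚ) (q : ℚ)
    (hout : ∀ i, a i ≤ 0 ∨ 1 ≤ a i) (hfirst : ∀ h : 0 < w, a ⟨0, h⟩ ≠ 1)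
    (hlast : ∀ h : 0 < w, a ⟨w - 1, Nat.sub_lt h one_pos⟩ ≠ 0) :
    IntegrableOn (fun t : Fin w → ℝ => (q : ℝ) * ∏ i, 1 / (t i - (a i : ℝ)))
      {t | (∀ i, 0 < t i) ∧ (∀ i, t i < 1) ∧ StrictAnti t} := by
  change IntegrableOn _ (KZ.openOrderedSimplex w) volume
  have hmeas : MeasurableSet (KZ.openOrderedSimplex w) := KZ.measurableSet_openOrderedSimplex w
  have haesm : AEStronglyMeasurable (fun t : Fin w → ℝ => (q : ℝ) * ∏ i, 1 / (t i - (a i : ℝ)))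
      (volume.restrict (KZ.openOrderedSimplex w)) :=
    (continuousOn_wordIntegrand a q hout).aestronglyMeasurable hmeas
  rcases Nat.eq_zero_or_pos w with rfl | hw
  · -- `ℝ^0` is a point: finite measure, constant integrand
    have : IsFiniteMeasure (volume : Measure (Fin 0 → ℝ)) := by
      rw [volume_pi, Measure.pi_of_empty]; infer_instance
    simp only [Finset.univ_eq_empty, Finset.prod_empty, mul_one]
    exact integrableOn_const
  -- the dominating pattern is admissible
  set K : ℝ := |(q : ℝ)| * ∏ i, letterBound (a i) with hK
  by_cases hw1 : w = 1
  · -- weight one: the single letter is outside `[0,1]`, the integrand is bounded by `K`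
    subst hw1
    have hsub : KZ.openOrderedSimplex 1 ⊆ Set.pi univ fun _ => Ioo (0 : ℝ) 1 := by
      intro t ht; exact Set.mem_univ_pi.mpr fun i => ⟨ht.1 i, ht.2.1 i⟩
    have hfin : volume (KZ.openOrderedSimplex 1) ≠ ⊤ := by
      refine ne_top_of_le_ne_top ?_ (measure_mono hsub)
      rw [volume_pi_pi]; simp
    refine IntegrableOn.of_bound hfin.lt_top haesm K ?_
    rw [ae_restrict_iff' hmeas]
    refine Filter.Eventually.of_forall fun t ht => ?_
    obtain ⟨h0, h1, -⟩ := ht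
    have ha0 : a 0 ≠ 0 := hlast one_pos
    have ha1 : a 0 ≠ 1 := hfirst one_pos
    rw [norm_mul, Real.norm_eq_abs, Real.norm_eq_abs, Fin.prod_univ_one, hK, Fin.prod_univ_one]
    refine mul_le_mul_of_nonneg_left ?_ (abs_nonneg _)
    -- |1/(t 0 − a 0)| ≤ letterBound (a 0): the outside case of `abs_inv_sub_le` without the form
    have hC : letterBound (a 0) = 1 / min |(a 0 : ℝ)| |(a 0 : ℝ) - 1| := by
      rw [letterBound, if_neg (by tauto)]
    have hδ : 0 < min |(a 0 : ℝ)| |(a 0 : ℝ) - 1| := by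
      have := letterBound_pos (a 0); rwa [hC, one_div_pos] at this
    rw [hC, abs_one_div, one_div_le_one_div (abs_pos.mpr ?_) hδ]
    · rcases hout 0 with h | h
      · have h' : (a 0 : ℝ) < 0 := by exact_mod_cast lt_of_le_of_ne h ha0
        calc min |(a 0 : ℝ)| |(a 0 : ℝ) - 1| ≤ |(a 0 : ℝ)| := min_le_left _ _
          _ = -(a 0 : ℝ) := abs_of_neg h'
          _ ≤ |t 0 - (a 0 : ℝ)| := by rw [abs_of_pos (by linarith [h0 0])]; linarith [h0 0]
      · have h' : (1 : ℝ) < a 0 := by exact_mod_cast lt_of_le_of_ne h (Ne.symm ha1)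
        calc min |(a 0 : ℝ)| |(a 0 : ℝ) - 1| ≤ |(a 0 : ℝ) - 1| := min_le_right _ _
          _ = (a 0 : ℝ) - 1 := abs_of_pos (by linarith)
          _ ≤ |t 0 - (a 0 : ℝ)| := by rw [abs_of_neg (by linarith [h1 0])]; linarith [h1 0]
    · intro hx
      rcases hout 0 with h | h
      · have h' : (a 0 : ℝ) ≤ 0 := by exact_mod_cast h
        linarith [sub_eq_zero.mp hx, h0 0]
      · have h' : (1 : ℝ) ≤ a 0 := by exact_mod_cast h
        linarith [sub_eq_zero.mp hx, h1 0]
  -- weight ≥ 2: dominate by the admissible MZV pattern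
  have hw2 : 2 ≤ w := by omega
  have hpat0 : pattern a 0 = false := by
    have h1 : a ⟨0, hw⟩ ≠ 1 := hfirst hw
    simp only [pattern, hw, ↓reduceDIte, h1, ↓reduceIte]
    split_ifs with h00
    · rfl
    · simp; omega
  have hpatl : pattern a (w - 1) = true := by
    have h1 : a ⟨w - 1, Nat.sub_lt hw one_pos⟩ ≠ 0 := hlast hw
    simp only [pattern, Nat.sub_lt hw one_pos, ↓reduceDIte, h1, ↓reduceIte, decide_true,
      ite_self]
  have hdom : IntegrableOn (fun t : Fin w → ℝ => K * ∏ i : Fin w, KZ.mzvForm (pattern a i) (t i))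
      (KZ.openOrderedSimplex w) :=
    (KZ.integrableOn_prod_mzvForm w (pattern a) (fun _ => hpat0) (fun _ => hpatl)).const_mul K
  refine Integrable.mono' hdom haesm ?_
  rw [ae_restrict_iff' hmeas]
  refine Filter.Eventually.of_forall fun t ht => ?_
  obtain ⟨h0, h1, -⟩ := ht
  rw [norm_mul, Real.norm_eq_abs, Real.norm_eq_abs, Finset.abs_prod, hK, mul_assoc,
    ← Finset.prod_mul_distrib]
  refine mul_le_mul_of_nonneg_left ?_ (abs_nonneg _)
  exact Finset.prod_le_prod (fun i _ => abs_nonneg _) fun i _ => abs_inv_sub_le a hout i (h0 i) (h1 i)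

/-- **Word representations exist for admissible rational words.** For `aᵢ ∉ (0,1)`, `a₀ ≠ 1`,
`a_{w−1} ≠ 0` and any `q ∈ ℚ` there is an integral representation of KZ's literal rational shape
(`ofRational`, integrand `C q / ∏ (Xᵢ − C aᵢ)`) on the open ordered simplex whose integrand is the
word integrand `q · ∏ᵢ 1/(tᵢ − aᵢ)` there — a generator of the target class of
`ArrangementNormalForm`. [folklore] -/
theorem exists_wordRep {w : ℕ} (a : Fin w → ℚ) (q : ℚ)
    (hout : ∀ i, a i ≤ 0 ∨ 1 ≤ a i) (hfirst : ∀ h : 0 < w, a ⟨0, h⟩ ≠ 1)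
    (hlast : ∀ h : 0 < w, a ⟨w - 1, Nat.sub_lt h one_pos⟩ ≠ 0) :
    ∃ s : KZ.IntegralRep w, s.IsRational ∧
      s.domain = {t | (∀ i, 0 < t i) ∧ (∀ i, t i < 1) ∧ StrictAnti t} ∧
      EqOn s.integrand (fun t => (q : ℝ) * ∏ i, 1 / (t i - (a i : ℝ))) s.domain := by
  have hne : ∀ t ∈ KZ.openOrderedSimplex w, ∀ i, t i - (a i : ℝ) ≠ 0 := by
    rintro t ⟨h0, h1, -⟩ i hx
    rcases hout i with h | h
    · have h' : (a i : ℝ) ≤ 0 := by exact_mod_cast h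
      linarith [sub_eq_zero.mp hx, h0 i]
    · have h' : (1 : ℝ) ≤ a i := by exact_mod_cast h
      linarith [sub_eq_zero.mp hx, h1 i]
  set P : MvPolynomial (Fin w) ℚ := MvPolynomial.C q with hP
  set Q : MvPolynomial (Fin w) ℚ := ∏ i, (MvPolynomial.X i - MvPolynomial.C (a i)) with hQ
  have hQeval : ∀ t : Fin w → ℝ, MvPolynomial.aeval t Q = ∏ i, (t i - (a i : ℝ)) := by
    intro t; simp [hQ, map_prod]
  have hPeval : ∀ t : Fin w → ℝ, MvPolynomial.aeval t P = (q : ℝ) := by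
    intro t; simp [hP]
  have hform : ∀ t, MvPolynomial.aeval t P / MvPolynomial.aeval t Q =
      (q : ℝ) * ∏ i, 1 / (t i - (a i : ℝ)) := by
    intro t
    rw [hPeval, hQeval, div_eq_mul_inv, ← Finset.prod_inv_distrib]
    simp only [one_div]
  have hQne : ∀ t ∈ KZ.openOrderedSimplex w, MvPolynomial.aeval t Q ≠ 0 := by
    intro t ht
    rw [hQeval]
    exact Finset.prod_ne_zero_iff.mpr fun i _ => hne t ht i
  have hint : IntegrableOn (fun t => MvPolynomial.aeval t P / MvPolynomial.aeval t Q)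
      (KZ.openOrderedSimplex w) := by
    simp_rw [hform]
    exact integrableOn_wordIntegrand a q hout hfirst hlast
  refine ⟨KZ.IntegralRep.ofRational (KZ.openOrderedSimplex w) P Q
    (KZ.isSemialgebraic_openOrderedSimplex w) hQne hint,
    KZ.IntegralRep.isRational_ofRational _ _ _ _ _ _, rfl, fun t _ => ?_⟩
  simp only [KZ.IntegralRep.integrand_ofRational]
  exact hform t

end WordReps

/-! ## §12 TRANSFER to the sibling crux `DihedralNormalForm` (stmt-KontsevichZagierPeriods-3912)

The genus-zero normal form has the SAME failure without rule (3): the witness `∫₀¹ 1 dt` is a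
genus-zero representation on the simplex `Δ₁ = (0,1)` (`P = 1`, all exponents `0`), MZV words of
weight one do not exist (both `1/t` and `1/(1−t)` diverge on `(0,1)`) unless `q = 0`, so the
dimension-`1` evaluation of the MZV-word closure is `{0} ⊆ logSpan`, while `evalDim 1 [Δ₁, 1] = 1`.
(No analogous transfer of §10: its witness lives on the cell `(1,2)`, not on a simplex.) -/

/-- The MZV word class of `DihedralNormalForm` / `MzvKernelInKZ`, exactly as inlined there. -/
def mzvWordReps : Set KZ.FormalRep :=
  {x | ∃ (w : ℕ) (ε : Fin w → Bool) (q : ℚ) (s : KZ.IntegralRep w),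
    s.domain = {t | (∀ i, 0 < t i) ∧ (∀ i, t i < 1) ∧ StrictAnti t} ∧
    EqOn s.integrand (fun t => (q : ℝ) * ∏ i, if ε i then 1 / (1 - t i) else 1 / t i) s.domain ∧
    x = KZ.of s}

/-- A weight-one MZV word is a rational word with letter `1` (and `q ↦ −q`) or letter `0`. -/
theorem value_mem_logSpan_of_mzvWordRep_one (s : KZ.IntegralRep 1) (ε : Fin 1 → Bool) (q : ℚ)
    (hdom : s.domain = {t | (∀ i, 0 < t i) ∧ (∀ i, t i < 1) ∧ StrictAnti t})
    (hint : EqOn s.integrand (fun t => (q : ℝ) * ∏ i, if ε i then 1 / (1 - t i) else 1 / t i)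
      s.domain) : s.value ∈ logSpan := by
  cases hε : ε 0
  · refine value_mem_logSpan_of_wordRep_one s (fun _ => 0) q hdom fun t ht => ?_
    rw [hint ht]
    simp [hε]
  · refine value_mem_logSpan_of_wordRep_one s (fun _ => 1) (-q) hdom fun t ht => ?_
    rw [hint ht]
    simp only [Fin.prod_univ_one, hε, ↓reduceIte, Rat.cast_neg, Rat.cast_one, neg_mul, one_div]
    rw [show (1 - t 0) = -(t 0 - 1) by ring, inv_neg]
    ring

/-- The dimension-one evaluation of the MZV-word closure lies in `logSpan`. -/
theorem closure_mzvWordReps_le_comap_evalDim_one :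
    AddSubgroup.closure mzvWordReps ≤ logSpan.toAddSubgroup.comap (evalDim 1) := by
  rw [AddSubgroup.closure_le]
  rintro y ⟨w, ε, q, s, hdom, hint, rfl⟩
  simp only [SetLike.mem_coe, AddSubgroup.mem_comap, evalDim_of, Submodule.mem_toAddSubgroup]
  by_cases hw : w = 1
  · subst hw
    rw [if_pos rfl]
    exact value_mem_logSpan_of_mzvWordRep_one s ε q hdom hint
  · rw [if_neg hw]
    exact zero_mem _

/-- `unitRep`'s cell IS the one-dimensional simplex (as a set). -/
theorem unitRep_domain_eq_simplex :
    unitRep.domain = {t : Fin 1 → ℝ | (∀ i, 0 < t i) ∧ (∀ i, t i < 1) ∧ StrictAnti t} := by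
  rw [unitRep_domain, cell_unitCell_eq, simplex_one_eq_preimage]

/-- `unitRep` satisfies the genus-zero integrand hypothesis with `P = 1` and all exponents `0`. -/
theorem unitRep_eqOn_dihedral :
    EqOn unitRep.integrand (fun t => MvPolynomial.aeval t (1 : MvPolynomial (Fin 1) ℚ) /
      ((∏ i, t i ^ (0 : Fin 1 → ℕ) i) * (∏ i, (1 - t i) ^ (0 : Fin 1 → ℕ) i) *
        ∏ i : Fin 1, ∏ j : Fin 1, if i < j then (t i - t j) ^ (0 : Fin 1 → Fin 1 → ℕ) i j else 1))
      unitRep.domain := by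
  intro t _
  simp [unitRep_integrand]

/-- **TRANSFER (rule 3 is load-bearing for `DihedralNormalForm` too).** The genus-zero normal
form with `KZ.relations` replaced by `relationsWithoutNL`, stated inline, is FALSE: witness
`[Δ₁, 1]`. [folklore] -/
theorem dihedralNormalForm_false_without_newtonLeibniz :
    ¬ ∀ (k : ℕ) (r : KZ.IntegralRep k) (p : MvPolynomial (Fin k) ℚ) (a : Fin k → Fin k → ℕ)
        (b c : Fin k → ℕ),
      r.domain = {t | (∀ i, 0 < t i) ∧ (∀ i, t i < 1) ∧ StrictAnti t} →
      EqOn r.integrand (fun t => MvPolynomial.aeval t p /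
        ((∏ i, t i ^ b i) * (∏ i, (1 - t i) ^ c i) *
          ∏ i, ∏ j, if i < j then (t i - t j) ^ a i j else 1)) r.domain →
      ∃ m ∈ AddSubgroup.closure mzvWordReps, KZ.of r - m ∈ relationsWithoutNL := by
  intro H
  obtain ⟨m, hm, hrel⟩ := H 1 unitRep 1 0 0 0 unitRep_domain_eq_simplex unitRep_eqOn_dihedral
  have h1 : evalDim 1 (KZ.of unitRep - m) = 0 := relationsWithoutNL_le_ker_evalDim 1 hrel
  rw [map_sub, evalDim_of, if_pos rfl, unitRep_value, sub_eq_zero] at h1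
  have hm' := closure_mzvWordReps_le_comap_evalDim_one hm
  rw [AddSubgroup.mem_comap, ← h1] at hm'
  exact one_not_mem_logSpan hm'

end Summit.KontsevichZagierPeriods.KontsevichZagierPeriods.Cruxes.ArrangementNormalForm.Disproof

/-! ## §10 LOAD-BEARING (rule 2): `ArrangementNormalForm` is false without the change-of-variables move
(also attached separately as `NoCoV.lean`)

LOAD-BEARING analysis of rule (2). We exhibit an additive invariant of the calculus generated by
rules (1a), (1b), (3) ONLY (`relationsWithoutCoV`): the **slice density class**
`D [σ, f] = (s ↦ ∫_{σ_s} f(s, ·)) mod (null functions + exact ℚ-semialgebraic densities)`,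
the marginal of `f·1_σ` on the first coordinate, taken modulo functions vanishing a.e. and modulo
the `ℤ`-span of densities `1_{[a,b]}·F'` of `ℚ`-semialgebraic primitives `F` (the slices of the
Newton–Leibniz move in dimension `1 → 0`). Rules (1a), (1b) and (3) in dimension `≥ 2 → ≥ 1` do
not change the slice function almost everywhere (Fubini; fundamental theorem of calculus on
cylinders), and rule (3) in dimension `1 → 0` changes it by an exact density. Word representations
have slices supported in `[0,1]`. The witness `[(1,2), 1/x]` (cell `1 < x < 2`, integrand `1/x`,
value `log 2`) has slice `1_{(1,2)}/x`, and `1/x` is not, on any rational subinterval of `(1,2)`,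
a.e. the derivative of a `ℤ`-combination of `ℚ`-semialgebraic functions — by the algebraic core of
the barrier `Literature.Barriers.KontsevichZagierPeriods.KZ` (no function algebraic over `ℝ(t)` has
derivative with a non-zero residue) after an `a.e. → everywhere` upgrade (minimal polynomial
relation + continuity). Hence without rule (2) the crux fails: ANY proof must use change of
variables (already to move the cell `(1,2)` onto the simplex `(0,1)`).
-/

namespace Summit.KontsevichZagierPeriods.ArrangementNormalForm.NoCoV

open MeasureTheory Set Filter
open Literature.NumberTheory.Transcendental

/-! ## §1 Slices (marginals on the first coordinate) -/

/-- The slice function of an `(n+1)`-dimensional representation: `s ↦ ∫_{σ_s} f(s, ·)`.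
[folklore] -/
def slice {n : ℕ} (R : KZ.IntegralRep (n + 1)) (s : ℝ) : ℝ :=
  ∫ x in {x : Fin n → ℝ | Matrix.vecCons s x ∈ R.domain}, R.integrand (Matrix.vecCons s x)

/-- The slice function is integrable. [folklore] -/
theorem integrable_slice {n : ℕ} (R : KZ.IntegralRep (n + 1)) : Integrable (slice R) :=
  KZ.integrable_integral_slice R

/-- `vecCons s x₀ = (s)` in `ℝ¹`. [folklore] -/
theorem vecCons_fin_zero (s : ℝ) (x : Fin 0 → ℝ) : Matrix.vecCons s x = fun _ => s := by
  funext i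
  rw [Fin.fin_one_eq_zero i]
  rfl

/-- Lebesgue measure on `ℝ⁰` is the Dirac mass. [folklore] -/
theorem volume_fin_zero : (volume : Measure (Fin 0 → ℝ)) = Measure.dirac (fun i => i.elim0) := by
  rw [volume_pi, Measure.pi_of_empty]
  congr 1

/-- **Slices in dimension one** are the function itself (extended by `0` off the domain).
[folklore] -/
theorem slice_dim_one (R : KZ.IntegralRep 1) (s : ℝ) :
    slice R s = R.domain.indicator R.integrand (fun _ => s) := by
  classical
  unfold slice
  rw [volume_fin_zero, setIntegral_dirac]
  simp only [mem_setOf_eq, vecCons_fin_zero, Set.indicator_apply]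

/-- **Partial Fubini**: the integral of the slice function over `A ⊆ ℝ` is the integral of the
representation over the cylinder `{z | z 0 ∈ A}`. [folklore] -/
theorem setIntegral_slice {n : ℕ} (R : KZ.IntegralRep (n + 1)) {A : Set ℝ} (hA : MeasurableSet A) :
    ∫ s in A, slice R s = ∫ z in R.domain ∩ {z | z 0 ∈ A}, R.integrand z := by
  have hC : MeasurableSet {z : Fin (n + 1) → ℝ | z 0 ∈ A} := measurable_pi_apply 0 hA
  have hD : MeasurableSet (R.domain ∩ {z : Fin (n + 1) → ℝ | z 0 ∈ A}) :=
    (KZ.IntegralRep.measurableSet_domain_holds R).inter hC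
  rw [← integral_indicator hD, ← KZ.integral_comp_vecCons]
  have hfun : (fun p : ℝ × (Fin n → ℝ) =>
      (R.domain ∩ {z : Fin (n + 1) → ℝ | z 0 ∈ A}).indicator R.integrand (Matrix.vecCons p.1 p.2)) =
      (A ×ˢ (univ : Set (Fin n → ℝ))).indicator
        (fun p => R.domain.indicator R.integrand (Matrix.vecCons p.1 p.2)) := by
    ext p
    by_cases hp : p.1 ∈ A
    · have : p ∈ A ×ˢ (univ : Set (Fin n → ℝ)) := Set.mk_mem_prod hp (mem_univ _)
      rw [indicator_of_mem this]
      by_cases hq : Matrix.vecCons p.1 p.2 ∈ R.domain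
      · rw [indicator_of_mem (Set.mem_inter hq (by simpa using hp)), indicator_of_mem hq]
      · rw [indicator_of_notMem (fun h => hq h.1), indicator_of_notMem hq]
    · have : p ∉ A ×ˢ (univ : Set (Fin n → ℝ)) := fun h => hp h.1
      rw [indicator_of_notMem this, indicator_of_notMem]
      intro h
      exact hp (by simpa using h.2)
  rw [hfun, integral_indicator (hA.prod MeasurableSet.univ), ← Measure.prod_restrict,
    Measure.restrict_univ]
  rw [integral_prod _ ((KZ.integrable_indicator_comp_vecCons R).mono_measure
    (Measure.prod_mono Measure.restrict_le_self le_rfl))]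
  simp only [slice, KZ.integral_indicator_comp_vecCons]

/-- **Newton–Leibniz on cylinders** (the soundness computation of
`KZ.eval_eq_zero_of_mem_newtonLeibnizRel_holds`, verbatim, for measurable data): Fubini along the
last coordinate and the fundamental theorem of calculus on each fibre. [folklore] -/
theorem integral_band_eq {m : ℕ} {τ : Set (Fin m → ℝ)} {B : Set (Fin (m + 1) → ℝ)}
    (hτm : MeasurableSet τ) (hbm : MeasurableSet B)
    {f : (Fin (m + 1) → ℝ) → ℝ} {g : (Fin m → ℝ) → ℝ} {a b : (Fin m → ℝ) → ℝ}
    {F : (Fin (m + 1) → ℝ) → ℝ} (hint : IntegrableOn f B)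
    (hab : ∀ x ∈ τ, a x ≤ b x)
    (hdom : B = {z | (Fin.init z : Fin m → ℝ) ∈ τ ∧ a (Fin.init z) ≤ z (Fin.last m) ∧
      z (Fin.last m) ≤ b (Fin.init z)})
    (hcont : ∀ x ∈ τ, ContinuousOn (fun t : ℝ => F (Fin.snoc x t)) (Icc (a x) (b x)))
    (hderiv : ∀ x ∈ τ, ∀ t ∈ Ioo (a x) (b x),
      HasDerivAt (fun s : ℝ => F (Fin.snoc x s)) (f (Fin.snoc x t)) t)
    (hg : ∀ x ∈ τ, g x = F (Fin.snoc x (b x)) - F (Fin.snoc x (a x))) :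
    ∫ z in B, f z = ∫ x in τ, g x := by
  set e : (Fin (m + 1) → ℝ) ≃ᵐ ℝ × (Fin m → ℝ) :=
    MeasurableEquiv.piFinSuccAbove (fun _ => ℝ) (Fin.last m) with he_def
  have he : MeasurePreserving e volume volume :=
    volume_preserving_piFinSuccAbove (fun _ => ℝ) (Fin.last m)
  have he_symm : ∀ p : ℝ × (Fin m → ℝ), e.symm p = Fin.snoc p.2 p.1 := fun p => by
    simp [he_def, MeasurableEquiv.piFinSuccAbove, Fin.snocEquiv]
  have hmem : ∀ x t, Fin.snoc x t ∈ B ↔ x ∈ τ ∧ t ∈ Icc (a x) (b x) := by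
    intro x t
    rw [hdom]
    simp only [mem_setOf_eq, Fin.init_snoc, Fin.snoc_last, mem_Icc]
  set G : (Fin (m + 1) → ℝ) → ℝ := B.indicator f with hG_def
  have hG : Integrable G := (integrable_indicator_iff hbm).mpr hint
  have hfib_in : ∀ x ∈ τ, (fun t => G (Fin.snoc x t)) =
      (Icc (a x) (b x)).indicator (fun t => f (Fin.snoc x t)) := by
    intro x hx
    ext t
    by_cases ht : t ∈ Icc (a x) (b x)
    · rw [Set.indicator_of_mem ht, hG_def, Set.indicator_of_mem ((hmem x t).2 ⟨hx, ht⟩)]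
    · rw [Set.indicator_of_notMem ht, hG_def,
        Set.indicator_of_notMem (fun h => ht ((hmem x t).1 h).2)]
  have hfib_out : ∀ x ∉ τ, (fun t => G (Fin.snoc x t)) = fun _ => 0 := by
    intro x hx
    ext t
    rw [hG_def, Set.indicator_of_notMem (fun h => hx ((hmem x t).1 h).1)]
  have hG2 : Integrable (fun p : ℝ × (Fin m → ℝ) => G (Fin.snoc p.2 p.1))
      ((volume : Measure ℝ).prod (volume : Measure (Fin m → ℝ))) := by
    have h := ((he.symm e).integrable_comp_emb e.symm.measurableEmbedding (g := G)).mpr hG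
    rw [← Measure.volume_eq_prod]
    convert h using 1
    ext p
    simp [he_symm]
  calc ∫ z in B, f z
      = ∫ z, G z := (integral_indicator hbm).symm
    _ = ∫ p, G (e.symm p) := ((he.symm e).integral_comp' G).symm
    _ = ∫ p : ℝ × (Fin m → ℝ), G (Fin.snoc p.2 p.1) ∂(volume.prod volume) := by
        simp_rw [he_symm, Measure.volume_eq_prod]
    _ = ∫ x, ∫ t, G (Fin.snoc x t) := integral_prod_symm _ hG2
    _ = ∫ x, τ.indicator (fun x => F (Fin.snoc x (b x)) - F (Fin.snoc x (a x))) x := by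
        apply integral_congr_ae
        filter_upwards [hG2.prod_left_ae] with x hx
        by_cases hxτ : x ∈ τ
        · rw [Set.indicator_of_mem hxτ, hfib_in x hxτ, integral_indicator measurableSet_Icc,
            integral_Icc_eq_integral_Ioc, ← intervalIntegral.integral_of_le (hab x hxτ)]
          apply intervalIntegral.integral_eq_sub_of_hasDerivAt_of_le (hab x hxτ) (hcont x hxτ)
            (hderiv x hxτ)
          rw [intervalIntegrable_iff_integrableOn_Icc_of_le (hab x hxτ)]
          have hx' : Integrable (fun t => G (Fin.snoc x t)) := hx
          rw [hfib_in x hxτ] at hx'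
          exact (integrable_indicator_iff measurableSet_Icc).mp hx'
        · rw [Set.indicator_of_notMem hxτ]
          rw [hfib_out x hxτ, integral_zero]
    _ = ∫ x in τ, (F (Fin.snoc x (b x)) - F (Fin.snoc x (a x))) := integral_indicator hτm
    _ = ∫ x in τ, g x := (setIntegral_congr_fun hτm fun x hx => hg x hx).symm

/-- `(Fin.init z) 0 = z 0` in dimension `≥ 2`. [folklore] -/
theorem init_apply_zero {k : ℕ} (z : Fin (k + 2) → ℝ) : (Fin.init z : Fin (k + 1) → ℝ) 0 = z 0 :=
  rfl

/-- **Rule (3) in dimension `k+2 → k+1` does not change the slice function (a.e.).** For a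
Newton–Leibniz datum the slice functions of band and base agree almost everywhere: both
integrate, over every measurable `A ⊆ ℝ`, to the integral over the cylinder `{z 0 ∈ A}`, where
the cylinder-restricted datum is again a Newton–Leibniz datum (`integral_band_eq`). [folklore] -/
theorem slice_ae_eq_of_newtonLeibniz {k : ℕ} (R : KZ.IntegralRep (k + 2)) (R' : KZ.IntegralRep (k + 1))
    (a b : (Fin (k + 1) → ℝ) → ℝ) (F : (Fin (k + 2) → ℝ) → ℝ)
    (hab : ∀ x ∈ R'.domain, a x ≤ b x)
    (hdom : R.domain = {z | (Fin.init z : Fin (k + 1) → ℝ) ∈ R'.domain ∧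
      a (Fin.init z) ≤ z (Fin.last (k + 1)) ∧ z (Fin.last (k + 1)) ≤ b (Fin.init z)})
    (hcont : ∀ x ∈ R'.domain, ContinuousOn (fun t : ℝ => F (Fin.snoc x t)) (Icc (a x) (b x)))
    (hderiv : ∀ x ∈ R'.domain, ∀ t ∈ Ioo (a x) (b x),
      HasDerivAt (fun s : ℝ => F (Fin.snoc x s)) (R.integrand (Fin.snoc x t)) t)
    (hr' : ∀ x ∈ R'.domain, R'.integrand x = F (Fin.snoc x (b x)) - F (Fin.snoc x (a x))) :
    slice R =ᵐ[volume] slice R' := by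
  refine Integrable.ae_eq_of_forall_setIntegral_eq _ _ (integrable_slice R) (integrable_slice R')
    fun A hA _ => ?_
  rw [setIntegral_slice R hA, setIntegral_slice R' hA]
  have hCk : MeasurableSet {z : Fin (k + 2) → ℝ | z 0 ∈ A} := measurable_pi_apply 0 hA
  have hCk' : MeasurableSet {x : Fin (k + 1) → ℝ | x 0 ∈ A} := measurable_pi_apply 0 hA
  refine integral_band_eq ((KZ.IntegralRep.measurableSet_domain_holds R').inter hCk')
    ((KZ.IntegralRep.measurableSet_domain_holds R).inter hCk) (F := F) (a := a) (b := b)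
    (R.integrableOn.mono_set inter_subset_left)
    (fun x hx => hab x hx.1) ?_ (fun x hx => hcont x hx.1) (fun x hx => hderiv x hx.1)
    (fun x hx => hr' x hx.1)
  ext z
  rw [hdom]
  simp only [mem_inter_iff, mem_setOf_eq]
  rw [show z 0 = (Fin.init z : Fin (k + 1) → ℝ) 0 from rfl]
  tauto

/-- **Rule (1b) does not change the slice function (a.e.).** [folklore] -/
theorem slice_ae_eq_of_integrandAdd {n : ℕ} (R R₁ R₂ : KZ.IntegralRep (n + 1))
    (h₁ : R₁.domain = R.domain) (h₂ : R₂.domain = R.domain)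
    (hadd : EqOn R.integrand (R₁.integrand + R₂.integrand) R.domain) :
    slice R =ᵐ[volume] slice R₁ + slice R₂ := by
  filter_upwards [KZ.ae_integral_slice_add_of_integrand h₁ h₂ hadd] with s hs
  exact hs

/-- **Rule (1a) does not change the slice function (a.e.).** [folklore] -/
theorem slice_ae_eq_of_domainAdd {n : ℕ} (R R₁ R₂ : KZ.IntegralRep (n + 1))
    (hdom : R.domain = R₁.domain ∪ R₂.domain) (hnull : volume (R₁.domain ∩ R₂.domain) = 0)
    (h₁ : EqOn R.integrand R₁.integrand R₁.domain) (h₂ : EqOn R.integrand R₂.integrand R₂.domain) :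
    slice R =ᵐ[volume] slice R₁ + slice R₂ := by
  filter_upwards [KZ.ae_integral_slice_add_of_domain hdom hnull h₁ h₂] with s hs
  exact hs

/-! ## §2 Exact densities: the slices of rule (3) in dimension `1 → 0` -/

/-- The EXACT `ℚ`-semialgebraic densities: `1_{[a,b]}·f` where `f` is, on `(a,b)`, the derivative
of a function `F` which is `ℚ`-semialgebraic on the strip `{a ≤ z₀ ≤ b} ⊆ ℝ¹`. [folklore] -/
def exactDensities : Set (ℝ → ℝ) :=
  {h | ∃ (a b : ℝ) (f : ℝ → ℝ) (F : (Fin 1 → ℝ) → ℝ), a ≤ b ∧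
    IsSemialgebraicFunOn ℚ {z : Fin 1 → ℝ | a ≤ z 0 ∧ z 0 ≤ b} F ∧
    (∀ t ∈ Ioo a b, HasDerivAt (fun s : ℝ => F (fun _ => s)) (f t) t) ∧
    h = (Icc a b).indicator f}

/-- `Fin.snoc x s = (s)` in `ℝ¹` for the empty tuple `x`. [folklore] -/
theorem snoc_fin_zero (x : Fin 0 → ℝ) (s : ℝ) : (Fin.snoc x s : Fin 1 → ℝ) = fun _ => s := by
  funext i
  rw [Fin.fin_one_eq_zero i]
  rfl

/-- **The slice of a Newton–Leibniz band in dimension one is an exact density** (or zero, when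
the base is empty). [folklore] -/
theorem slice_mem_closure_exact (R : KZ.IntegralRep 1) (R' : KZ.IntegralRep 0)
    (a b : (Fin 0 → ℝ) → ℝ) (F : (Fin 1 → ℝ) → ℝ)
    (hF : IsSemialgebraicFunOn ℚ R.domain F)
    (hab : ∀ x ∈ R'.domain, a x ≤ b x)
    (hdom : R.domain = {z | (Fin.init z : Fin 0 → ℝ) ∈ R'.domain ∧
      a (Fin.init z) ≤ z (Fin.last 0) ∧ z (Fin.last 0) ≤ b (Fin.init z)})
    (hderiv : ∀ x ∈ R'.domain, ∀ t ∈ Ioo (a x) (b x),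
      HasDerivAt (fun s : ℝ => F (Fin.snoc x s)) (R.integrand (Fin.snoc x t)) t) :
    slice R ∈ AddSubgroup.closure exactDensities := by
  set e : Fin 0 → ℝ := fun i => i.elim0 with he
  have hinit : ∀ z : Fin 1 → ℝ, (Fin.init z : Fin 0 → ℝ) = e := fun z => Subsingleton.elim _ _
  by_cases hτ : e ∈ R'.domain
  · -- non-empty base: the band is the strip `{a e ≤ z 0 ≤ b e}`
    have hdom' : R.domain = {z : Fin 1 → ℝ | a e ≤ z 0 ∧ z 0 ≤ b e} := by
      rw [hdom]
      ext z
      simp only [mem_setOf_eq, hinit z, hτ, true_and]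
      rfl
    refine AddSubgroup.subset_closure ⟨a e, b e, fun s => R.integrand (fun _ => s), F, hab e hτ,
      hdom' ▸ hF, fun t ht => ?_, ?_⟩
    · have := hderiv e hτ t ht
      simpa only [snoc_fin_zero] using this
    · funext s
      rw [slice_dim_one, hdom']
      simp only [Set.indicator_apply, mem_setOf_eq, mem_Icc]
  · -- empty base: the band is empty and the slice vanishes
    have hdom' : R.domain = ∅ := by
      rw [hdom]
      ext z
      simp only [mem_setOf_eq, hinit z, hτ, false_and, mem_empty_iff_false]
    have : slice R = 0 := by
      funext s
      rw [slice_dim_one, hdom']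
      simp
    rw [this]
    exact zero_mem _

/-! ## §3 The invariant: slice density class modulo null functions and exact densities -/

/-- Functions vanishing almost everywhere. [folklore] -/
def nullFunctions : AddSubgroup (ℝ → ℝ) where
  carrier := {h | h =ᵐ[volume] 0}
  zero_mem' := by simp
  add_mem' := by
    intro f g hf hg
    have hf' : f =ᵐ[volume] 0 := hf
    have hg' : g =ᵐ[volume] 0 := hg
    have := hf'.add hg'
    simpa using this
  neg_mem' := by
    intro f hf
    have hf' : f =ᵐ[volume] 0 := hf
    have := hf'.neg
    simpa using this

theorem mem_nullFunctions_iff {h : ℝ → ℝ} : h ∈ nullFunctions ↔ h =ᵐ[volume] 0 := Iff.rfl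

/-- The subgroup killed by the invariant: null functions plus the `ℤ`-span of exact densities.
[folklore] -/
def killed : AddSubgroup (ℝ → ℝ) := nullFunctions ⊔ AddSubgroup.closure exactDensities

/-- The slice function of a generator of the formal group (zero in dimension `0`). [folklore] -/
def sliceSigma : (Σ n, KZ.IntegralRep n) → (ℝ → ℝ)
  | ⟨0, _⟩ => 0
  | ⟨_ + 1, R⟩ => slice R

/-- The slice function, extended additively to the formal group. [folklore] -/
def sliceFun : KZ.FormalRep →+ (ℝ → ℝ) := FreeAbelianGroup.lift sliceSigma

@[simp] theorem sliceFun_of_zero (R : KZ.IntegralRep 0) : sliceFun (KZ.of R) = 0 :=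
  FreeAbelianGroup.lift_apply_of _ _

@[simp] theorem sliceFun_of_succ {n : ℕ} (R : KZ.IntegralRep (n + 1)) :
    sliceFun (KZ.of R) = slice R :=
  FreeAbelianGroup.lift_apply_of _ _

/-- **The invariant** `D : FormalRep →+ (ℝ → ℝ) ⧸ killed`. [folklore] -/
def D : KZ.FormalRep →+ (ℝ → ℝ) ⧸ killed := (QuotientAddGroup.mk' killed).comp sliceFun

theorem D_eq_zero_iff (c : KZ.FormalRep) : D c = 0 ↔ sliceFun c ∈ killed := by
  simp [D]

/-- The relations of the calculus WITHOUT rule (2): generated by (1a), (1b), (3) only.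
[folklore] -/
def relationsWithoutCoV : AddSubgroup KZ.FormalRep :=
  AddSubgroup.closure (KZ.domainAddRel ∪ KZ.integrandAddRel ∪ KZ.newtonLeibnizRel)

theorem relationsWithoutCoV_le_relations : relationsWithoutCoV ≤ KZ.relations := by
  refine AddSubgroup.closure_mono ?_
  rintro c ((hc | hc) | hc)
  · exact Or.inl (Or.inl (Or.inl hc))
  · exact Or.inl (Or.inl (Or.inr hc))
  · exact Or.inr hc

theorem mem_killed_of_ae_eq_zero {h : ℝ → ℝ} (hh : h =ᵐ[volume] 0) : h ∈ killed :=
  AddSubgroup.mem_sup_left hh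

/-- **`D` kills every move except change of variables.** [folklore] -/
theorem relationsWithoutCoV_le_ker_D : relationsWithoutCoV ≤ D.ker := by
  refine (AddSubgroup.closure_le _).mpr ?_
  rintro c ((hc | hc) | hc)
  · -- (1a) domain additivity
    obtain ⟨n, r, r₁, r₂, hdom, hnull, h₁, h₂, rfl⟩ := hc
    rw [SetLike.mem_coe, AddMonoidHom.mem_ker, D_eq_zero_iff]
    cases n with
    | zero => simp [zero_mem]
    | succ n =>
      simp only [map_sub, sliceFun_of_succ]
      apply mem_killed_of_ae_eq_zero
      filter_upwards [slice_ae_eq_of_domainAdd r r₁ r₂ hdom hnull h₁ h₂] with s hs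
      simp [hs]
  · -- (1b) integrand additivity
    obtain ⟨n, r, r₁, r₂, h₁, h₂, hadd, rfl⟩ := hc
    rw [SetLike.mem_coe, AddMonoidHom.mem_ker, D_eq_zero_iff]
    cases n with
    | zero => simp [zero_mem]
    | succ n =>
      simp only [map_sub, sliceFun_of_succ]
      apply mem_killed_of_ae_eq_zero
      filter_upwards [slice_ae_eq_of_integrandAdd r r₁ r₂ h₁ h₂ hadd] with s hs
      simp [hs]
  · -- (3) Newton–Leibniz
    obtain ⟨n, r, r', a, b, F, hF, -, -, hab, hdom, hcont, hderiv, hr', rfl⟩ := hc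
    rw [SetLike.mem_coe, AddMonoidHom.mem_ker, D_eq_zero_iff]
    cases n with
    | zero =>
      simp only [map_sub, sliceFun_of_succ, sliceFun_of_zero, sub_zero]
      exact AddSubgroup.mem_sup_right (slice_mem_closure_exact r r' a b F hF hab hdom hderiv)
    | succ k =>
      simp only [map_sub, sliceFun_of_succ]
      apply mem_killed_of_ae_eq_zero
      filter_upwards [slice_ae_eq_of_newtonLeibniz r r' a b F hab hdom hcont hderiv hr'] with s hs
      simp [hs]


/-! ## §4 Word representations have slices supported in `(0,1)` -/

/-- The target class of the crux: hyperlogarithm WORD representations with rational letters,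
`[Δ_w, q · ∏ᵢ 1/(tᵢ − aᵢ)]`, exactly as inlined in `ArrangementNormalForm`. [folklore] -/
def wordReps : Set KZ.FormalRep :=
  {y | ∃ (w : ℕ) (a : Fin w → ℚ) (q : ℚ) (s : KZ.IntegralRep w),
    s.domain = {t | (∀ i, 0 < t i) ∧ (∀ i, t i < 1) ∧ StrictAnti t} ∧
    EqOn s.integrand (fun t => (q : ℝ) * ∏ i, 1 / (t i - (a i : ℝ))) s.domain ∧ y = KZ.of s}

/-- The slice function of anything in the word closure vanishes off `(0,1)`: a word of weight
`w ≥ 1` has domain inside `{0 < t₀ < 1}`, and weight-`0` words have no slice. [folklore] -/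
theorem sliceFun_eq_zero_of_not_mem {c : KZ.FormalRep} (hc : c ∈ AddSubgroup.closure wordReps)
    {s : ℝ} (hs : s ∉ Ioo (0 : ℝ) 1) : sliceFun c s = 0 := by
  induction hc using AddSubgroup.closure_induction with
  | mem y hy =>
    obtain ⟨w, a, q, S, hdom, -, rfl⟩ := hy
    cases w with
    | zero => simp
    | succ w =>
      rw [sliceFun_of_succ]
      unfold slice
      have hempty : {x : Fin w → ℝ | Matrix.vecCons s x ∈ S.domain} = ∅ := by
        ext x
        simp only [mem_setOf_eq, mem_empty_iff_false, iff_false, hdom]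
        rintro ⟨h0, h1, -⟩
        exact hs ⟨by simpa using h0 0, by simpa using h1 0⟩
      rw [hempty, Measure.restrict_empty, integral_zero_measure]
  | zero => simp
  | add x y _ _ hx hy => simp [hx, hy]
  | neg x _ hx => simp [hx]

/-! ## §5 The witness `[(1,2), 1/x]` -/

/-- Every open rational polyhedral cell is `ℚ`-semialgebraic. [folklore] -/
theorem isSemialgebraic_cell {n m' : ℕ} (M : Fin m' → (Fin n → ℚ) × ℚ) :
    Literature.ModelTheory.ExponentialFields.IsSemialgebraic ℚ
      {x : Fin n → ℝ | ∀ j, 0 < ∑ i, ((M j).1 i : ℝ) * x i + ((M j).2 : ℝ)} := by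
  have : {x : Fin n → ℝ | ∀ j, 0 < ∑ i, ((M j).1 i : ℝ) * x i + ((M j).2 : ℝ)} =
      ⋂ j ∈ (Finset.univ : Finset (Fin m')), {x | 0 < MvPolynomial.aeval x
        ((∑ i, MvPolynomial.C ((M j).1 i) * MvPolynomial.X i + MvPolynomial.C (M j).2 :
          MvPolynomial (Fin n) ℚ))} := by
    ext x
    simp [map_sum]
  rw [this]
  exact Literature.ModelTheory.ExponentialFields.IsSemialgebraic.biInter _ _ fun j _ =>
    Literature.ModelTheory.ExponentialFields.isSemialgebraic_setOf_eval_pos (k := ℚ) _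

/-- Rows of the cell `1 < x < 2` in `ℝ¹`: `x₀ − 1 > 0` and `−x₀ + 2 > 0`. [folklore] -/
def cellRows : Fin 2 → (Fin 1 → ℚ) × ℚ := ![(fun _ => 1, -1), (fun _ => -1, 2)]

/-- The single linear form `x₀` of the witness. [folklore] -/
def lineRows : Fin 1 → (Fin 1 → ℚ) × ℚ := ![(fun _ => 1, 0)]

/-- The cell of `cellRows` is `(1,2)`. [folklore] -/
theorem mem_cell_iff (x : Fin 1 → ℝ) :
    x ∈ {x : Fin 1 → ℝ | ∀ j, 0 < ∑ i, ((cellRows j).1 i : ℝ) * x i + ((cellRows j).2 : ℝ)} ↔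
      x 0 ∈ Ioo (1 : ℝ) 2 := by
  simp only [cellRows, mem_setOf_eq, Fin.forall_fin_two, Fin.sum_univ_one, Matrix.cons_val_zero,
    Matrix.cons_val_one, mem_Ioo]
  push_cast
  constructor
  · rintro ⟨h1, h2⟩; exact ⟨by linarith, by linarith⟩
  · rintro ⟨h1, h2⟩; exact ⟨by linarith, by linarith⟩

theorem cell_eq_preimage :
    {x : Fin 1 → ℝ | ∀ j, 0 < ∑ i, ((cellRows j).1 i : ℝ) * x i + ((cellRows j).2 : ℝ)} =
      (MeasurableEquiv.funUnique (Fin 1) ℝ) ⁻¹' Ioo 1 2 := by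
  ext x
  rw [mem_cell_iff]
  rfl

/-- The cell `(1,2) ⊂ ℝ¹` has finite volume. [folklore] -/
theorem volume_cell_lt_top :
    volume {x : Fin 1 → ℝ | ∀ j, 0 < ∑ i, ((cellRows j).1 i : ℝ) * x i + ((cellRows j).2 : ℝ)}
      < ⊤ := by
  rw [cell_eq_preimage]
  have h := (volume_preserving_funUnique (Fin 1) ℝ).measure_preimage
    (s := Ioo (1 : ℝ) 2) measurableSet_Ioo.nullMeasurableSet
  exact h.trans_lt (by simp)

/-- **The witness** `r₀ = [(1,2), 1/x]`: cell `cellRows`, `P = 1`, one linear form `x₀` with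
exponent `1` (value `log 2`). [folklore] -/
def r₀ : KZ.IntegralRep 1 :=
  KZ.IntegralRep.ofRational
    {x : Fin 1 → ℝ | ∀ j, 0 < ∑ i, ((cellRows j).1 i : ℝ) * x i + ((cellRows j).2 : ℝ)}
    1 (MvPolynomial.X 0) (isSemialgebraic_cell cellRows)
    (fun x hx => by
      have h := (mem_cell_iff x).mp hx
      simp only [MvPolynomial.aeval_X, ne_eq]
      linarith [h.1])
    (by
      have hmeas : MeasurableSet {x : Fin 1 → ℝ | ∀ j, 0 < ∑ i, ((cellRows j).1 i : ℝ) * x i +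
          ((cellRows j).2 : ℝ)} :=
        Literature.ModelTheory.ExponentialFields.IsSemialgebraic.measurableSet_holds
          (isSemialgebraic_cell cellRows)
      have hcont : ContinuousOn (fun x : Fin 1 → ℝ => MvPolynomial.aeval x (1 : MvPolynomial (Fin 1) ℚ) /
          MvPolynomial.aeval x (MvPolynomial.X 0 : MvPolynomial (Fin 1) ℚ))
          {x : Fin 1 → ℝ | ∀ j, 0 < ∑ i, ((cellRows j).1 i : ℝ) * x i + ((cellRows j).2 : ℝ)} := by
        refine ContinuousOn.div ((continuousOn_const (c := (1 : ℝ))).congr fun x _ => by simp) ?_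
          fun x hx => ?_
        · simpa using (continuous_apply 0).continuousOn
        · have h := (mem_cell_iff x).mp hx
          simp only [MvPolynomial.aeval_X, ne_eq]
          linarith [h.1]
      refine IntegrableOn.of_bound volume_cell_lt_top (hcont.aestronglyMeasurable hmeas) 1 ?_
      rw [ae_restrict_iff' hmeas]
      refine Filter.Eventually.of_forall fun x hx => ?_
      have h := (mem_cell_iff x).mp hx
      have hx0 : 0 < x 0 := zero_lt_one.trans h.1
      simp only [map_one, MvPolynomial.aeval_X]
      rw [Real.norm_eq_abs, abs_of_pos (by positivity), div_le_one hx0]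
      exact h.1.le)

theorem r₀_domain :
    r₀.domain = {x : Fin 1 → ℝ | ∀ j, 0 < ∑ i, ((cellRows j).1 i : ℝ) * x i + ((cellRows j).2 : ℝ)} :=
  rfl

theorem r₀_integrand : r₀.integrand = fun x => 1 / x 0 := by
  ext x; simp [r₀]

/-- `r₀` satisfies the integrand hypothesis of the crux with `P = 1`, `L₀ = x₀`, `e₀ = 1`.
[folklore] -/
theorem r₀_eqOn :
    EqOn r₀.integrand (fun x => MvPolynomial.aeval x (1 : MvPolynomial (Fin 1) ℚ) /
      ∏ j : Fin 1, (∑ i, ((lineRows j).1 i : ℝ) * x i + ((lineRows j).2 : ℝ)) ^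
        ((fun _ => 1 : Fin 1 → ℕ) j)) r₀.domain := by
  intro x _
  simp [r₀_integrand, lineRows]

/-- The slice of the witness is `1_{(1,2)}(s)/s`. [folklore] -/
theorem slice_r₀ (s : ℝ) : slice r₀ s = (Ioo (1 : ℝ) 2).indicator (fun s => 1 / s) s := by
  rw [slice_dim_one, r₀_integrand, r₀_domain]
  simp only [Set.indicator_apply, mem_cell_iff, mem_Ioo]

/-- The closed strip `{α ≤ z₀ ≤ β} ⊆ ℝ¹` is `ℚ`-semialgebraic. [folklore] -/
theorem isSemialgebraic_strip (α β : ℚ) :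
    Literature.ModelTheory.ExponentialFields.IsSemialgebraic ℚ
      {z : Fin 1 → ℝ | (α : ℝ) ≤ z 0 ∧ z 0 ≤ (β : ℝ)} := by
  have h1 := Literature.ModelTheory.ExponentialFields.isSemialgebraic_setOf_eval_le (k := ℚ)
    (R := ℝ) (ι := Fin 1) (MvPolynomial.C α) (MvPolynomial.X 0)
  have h2 := Literature.ModelTheory.ExponentialFields.isSemialgebraic_setOf_eval_le (k := ℚ)
    (R := ℝ) (ι := Fin 1) (MvPolynomial.X 0) (MvPolynomial.C β)
  have hset : {z : Fin 1 → ℝ | (α : ℝ) ≤ z 0 ∧ z 0 ≤ (β : ℝ)} =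
      {x : Fin 1 → ℝ | MvPolynomial.aeval x (MvPolynomial.C α : MvPolynomial (Fin 1) ℚ) ≤
          MvPolynomial.aeval x (MvPolynomial.X 0 : MvPolynomial (Fin 1) ℚ)} ∩
        {x : Fin 1 → ℝ | MvPolynomial.aeval x (MvPolynomial.X 0 : MvPolynomial (Fin 1) ℚ) ≤
          MvPolynomial.aeval x (MvPolynomial.C β : MvPolynomial (Fin 1) ℚ)} := by
    ext z
    simp
  rw [hset]
  exact h1.inter h2

/-! ## §6 The analytic heart: `1/x` is not a.e. an exact `ℚ`-semialgebraic density -/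

section Heart

open Polynomial
open scoped Polynomial.Bivariate

/-- **(A) Polynomial relation.** A `ℚ`-semialgebraic function of one variable on a closed strip
`{a ≤ z₀ ≤ b}` satisfies a non-trivial real polynomial relation (verbatim the argument of
`Literature.Barriers.KontsevichZagierPeriods.KZ.NoSemialgPrimKernel.exists_ne_zero_evalEval_eq_zero`,
whose domain `[0,1]` plays no role). [folklore] -/
theorem exists_polyRel {a b : ℝ} {G : (Fin 1 → ℝ) → ℝ}
    (hG : IsSemialgebraicFunOn ℚ {z : Fin 1 → ℝ | a ≤ z 0 ∧ z 0 ≤ b} G) :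
    ∃ P : ℝ[X][Y], P ≠ 0 ∧ ∀ t ∈ Icc a b, P.evalEval t (G fun _ => t) = 0 := by
  set S : Set (Fin 1 → ℝ) := {z : Fin 1 → ℝ | a ≤ z 0 ∧ z 0 ≤ b} with hS
  set Γ : Set (Fin 2 → ℝ) := {z | ∃ x ∈ S, z = Fin.snoc x (G x)} with hΓ
  have hΓ' : Literature.ModelTheory.ExponentialFields.IsSemialgebraic ℚ Γ := hG
  obtain ⟨q, hq0, hopen, -⟩ :=
    Literature.Barriers.KontsevichZagierPeriods.KZ.NoSemialgPrim.exists_ne_zero_isOpen hΓ'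
  have hvan : ∀ z ∈ Γ, MvPolynomial.eval z q = 0 := by
    intro z hz
    by_contra hne
    obtain ⟨ε, hε, hball⟩ := Metric.isOpen_iff.mp hopen z ⟨hz, hne⟩
    obtain ⟨x, hx, rfl⟩ := hz
    have hmem : (Fin.snoc x (G x + ε / 2) : Fin 2 → ℝ) ∈
        Metric.ball (Fin.snoc x (G x) : Fin 2 → ℝ) ε := by
      rw [Metric.mem_ball, dist_pi_lt_iff hε]
      intro i
      fin_cases i
      · simp [Fin.snoc, hε]
      · simp [Fin.snoc, abs_of_pos hε, half_lt_self hε]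
    obtain ⟨⟨x', -, hxx'⟩, -⟩ := hball hmem
    have h0 : x = x' := by
      funext j
      fin_cases j
      simpa [Fin.snoc] using congrFun hxx' 0
    have h1 := congrFun hxx' 1
    simp only [Fin.snoc] at h1
    simp [← h0] at h1
    exact absurd h1 hε.ne'
  refine ⟨(Polynomial.Bivariate.equivMvPolynomial ℝ).symm q, by simpa using hq0, ?_⟩
  intro t ht
  have hz : (Fin.snoc (fun _ : Fin 1 => t) (G fun _ => t) : Fin 2 → ℝ) ∈ Γ :=
    ⟨fun _ => t, ⟨ht.1, ht.2⟩, rfl⟩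
  have h := hvan _ hz
  rw [← Literature.Barriers.KontsevichZagierPeriods.KZ.NoSemialgPrim.evalEval_equivMvPolynomial_symm]
    at h
  simpa [Fin.snoc] using h

/-- `P(x, y)` as a sum over the `Y`-coefficients. [folklore] -/
theorem evalEval_eq_sum_range (P : ℝ[X][Y]) (x y : ℝ) :
    P.evalEval x y = ∑ j ∈ Finset.range (P.natDegree + 1), (P.coeff j).eval x * y ^ j := by
  simp only [Polynomial.evalEval]
  conv_lhs => rw [P.as_sum_range]
  simp only [Polynomial.eval_finsetSum, Polynomial.eval_monomial, Polynomial.eval_mul,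
    Polynomial.eval_pow, Polynomial.eval_C]

/-- `∂P/∂y (x, y)` as a sum over the `Y`-coefficients. [folklore] -/
theorem evalEval_derivative_eq_sum (P : ℝ[X][Y]) (x y : ℝ) :
    (derivative P).evalEval x y =
      ∑ j ∈ Finset.range (P.natDegree + 1), (j : ℝ) * (P.coeff j).eval x * y ^ (j - 1) := by
  simp only [Polynomial.evalEval]
  rw [Polynomial.derivative_eval, Polynomial.sum_over_range]
  · simp only [Polynomial.eval_finsetSum, Polynomial.eval_mul, Polynomial.eval_natCast,
      Polynomial.eval_pow, Polynomial.eval_C]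
    exact Finset.sum_congr rfl fun j _ => by ring
  · intro n
    simp

/-- **Differentiating a polynomial relation along the graph** (general interval form of
`NoSemialgPrimKernel.sum_deriv_eq_zero`): if `g' = φ` on `(α, β)` and `Q(t, g t) = 0` there,
then `∑ⱼ qⱼ'(t) g(t)ʲ + (∂Q/∂y)(t, g t) · φ t = 0` there. [folklore] -/
theorem deriv_polyRel {α β : ℝ} {g φ : ℝ → ℝ} (hderiv : ∀ x ∈ Ioo α β, HasDerivAt g (φ x) x)
    (Q : ℝ[X][Y]) (hQv : ∀ t ∈ Ioo α β, Q.evalEval t (g t) = 0) {t : ℝ} (ht : t ∈ Ioo α β) :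
    (∑ j ∈ Finset.range (Q.natDegree + 1), (derivative (Q.coeff j)).eval t * g t ^ j)
      + (derivative Q).evalEval t (g t) * φ t = 0 := by
  set M := Q.natDegree + 1 with hM
  have hf : HasDerivAt (fun s => ∑ j ∈ Finset.range M, (Q.coeff j).eval s * g s ^ j)
      (∑ j ∈ Finset.range M, ((derivative (Q.coeff j)).eval t * g t ^ j +
        (Q.coeff j).eval t * ((j : ℝ) * g t ^ (j - 1) * φ t))) t :=
    HasDerivAt.fun_sum fun j _ => ((Q.coeff j).hasDerivAt t).mul ((hderiv t ht).pow j)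
  have h0 : HasDerivAt (fun s => ∑ j ∈ Finset.range M, (Q.coeff j).eval s * g s ^ j) 0 t := by
    apply (hasDerivAt_const t (0 : ℝ)).congr_of_eventuallyEq
    filter_upwards [Ioo_mem_nhds ht.1 ht.2] with s hs
    rw [hM, ← evalEval_eq_sum_range]
    exact hQv s hs
  have hsum := hf.unique h0
  rw [evalEval_derivative_eq_sum]
  calc (∑ j ∈ Finset.range M, (derivative (Q.coeff j)).eval t * g t ^ j) +
        (∑ j ∈ Finset.range M, (j : ℝ) * (Q.coeff j).eval t * g t ^ (j - 1)) * φ t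
      = ∑ j ∈ Finset.range M, ((derivative (Q.coeff j)).eval t * g t ^ j +
          (Q.coeff j).eval t * ((j : ℝ) * g t ^ (j - 1) * φ t)) := by
        rw [Finset.sum_mul, ← Finset.sum_add_distrib]
        exact Finset.sum_congr rfl fun j _ => by ring
    _ = 0 := hsum

/-- **(B) The `a.e. → everywhere` upgrade.** If `g' = φ` on `(α,β)` (`0 < α`), `φ = 1/x` a.e.
there, and `g` satisfies a non-trivial polynomial relation along its graph, then `g' = 1/x`
EVERYWHERE on some rational subinterval: take a relation `Q` of minimal `Y`-degree; then
`∂Q/∂y` does not vanish identically along the graph (minimality), so near a good point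
`φ = −(∂Q/∂x)/(∂Q/∂y)` along the graph is CONTINUOUS, and two continuous functions which agree
a.e. on an open interval agree everywhere (`Measure.eqOn_open_of_ae_eq`). [folklore] -/
theorem upgrade_ae_deriv {α β : ℝ} (h0 : 0 < α) (hαβ : α < β) {g φ : ℝ → ℝ}
    (hderiv : ∀ x ∈ Ioo α β, HasDerivAt g (φ x) x)
    (hae : ∀ᵐ x, x ∈ Ioo α β → φ x = 1 / x)
    (hrel : ∃ P : ℝ[X][Y], P ≠ 0 ∧ ∀ t ∈ Ioo α β, P.evalEval t (g t) = 0) :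
    ∃ α₁ β₁ : ℚ, α < α₁ ∧ α₁ < β₁ ∧ (β₁ : ℝ) < β ∧
      ∀ x ∈ Ioo (α₁ : ℝ) β₁, HasDerivAt g (1 / x) x := by
  classical
  obtain ⟨P, hP0, hPv⟩ := hrel
  -- a relation of minimal `Y`-degree
  have hex : ∃ d, ∃ P : ℝ[X][Y], P ≠ 0 ∧ P.natDegree = d ∧ ∀ t ∈ Ioo α β, P.evalEval t (g t) = 0 :=
    ⟨_, P, hP0, rfl, hPv⟩
  obtain ⟨Q, hQ0, hQd, hQv⟩ := Nat.find_spec hex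
  have hmin : ∀ P : ℝ[X][Y], P ≠ 0 → (∀ t ∈ Ioo α β, P.evalEval t (g t) = 0) →
      Nat.find hex ≤ P.natDegree :=
    fun P hP0 hPv => Nat.find_min' hex ⟨P, hP0, rfl, hPv⟩
  -- `∂Q/∂y ≠ 0` and of smaller degree, hence not identically zero along the graph
  have hQdeg : Q.natDegree ≠ 0 := by
    intro hdeg
    have hQC : Q = C (Q.coeff 0) := eq_C_of_natDegree_eq_zero hdeg
    have hc0 : Q.coeff 0 = 0 := by
      apply Polynomial.eq_zero_of_infinite_isRoot
      refine Set.Infinite.mono (fun t ht => ?_) (Ioo_infinite hαβ)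
      have := hQv t ht
      rw [hQC, evalEval_C] at this
      exact this
    exact hQ0 (by rw [hQC, hc0, map_zero])
  have hQy0 : derivative Q ≠ 0 := by
    intro hzero
    exact hQdeg (Polynomial.derivative_eq_zero.mp hzero)
  have hQy_deg : (derivative Q).natDegree < Nat.find hex := by
    rw [← hQd]
    exact natDegree_derivative_lt hQdeg
  have hx₁ : ∃ x₁ ∈ Ioo α β, (derivative Q).evalEval x₁ (g x₁) ≠ 0 := by
    by_contra hall
    push Not at hall
    exact absurd (hmin _ hQy0 hall) (not_le.mpr hQy_deg)
  obtain ⟨x₁, hx₁, hB₁⟩ := hx₁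
  -- the coefficient functions `A = Σ qⱼ' gʲ`, `B = ∂Q/∂y` along the graph are continuous
  set A : ℝ → ℝ := fun t =>
    ∑ j ∈ Finset.range (Q.natDegree + 1), (derivative (Q.coeff j)).eval t * g t ^ j with hA
  set B : ℝ → ℝ := fun t => (derivative Q).evalEval t (g t) with hB
  have hgcont : ContinuousOn g (Ioo α β) := fun t ht =>
    (hderiv t ht).continuousAt.continuousWithinAt
  have hAcont : ContinuousOn A (Ioo α β) := by
    refine continuousOn_finsetSum _ fun j _ => ?_
    exact (Polynomial.continuous _).continuousOn.mul (hgcont.pow j)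
  have hBcont : ContinuousOn B (Ioo α β) := by
    have : B = fun t => ∑ j ∈ Finset.range (Q.natDegree + 1),
        (j : ℝ) * (Q.coeff j).eval t * g t ^ (j - 1) := by
      funext t; rw [hB]; exact evalEval_derivative_eq_sum Q t (g t)
    rw [this]
    refine continuousOn_finsetSum _ fun j _ => ?_
    exact ((continuousOn_const.mul (Polynomial.continuous _).continuousOn)).mul (hgcont.pow _)
  have hident : ∀ t ∈ Ioo α β, A t + B t * φ t = 0 := fun t ht => deriv_polyRel hderiv Q hQv ht
  -- a rational interval around `x₁` where `B ≠ 0`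
  have hev : ∀ᶠ t in nhds x₁, B t ≠ 0 ∧ t ∈ Ioo α β :=
    ((hBcont.continuousAt (Ioo_mem_nhds hx₁.1 hx₁.2)).eventually_ne hB₁).and
      (Ioo_mem_nhds hx₁.1 hx₁.2)
  obtain ⟨ε, hε, hball⟩ := Metric.eventually_nhds_iff.mp hev
  obtain ⟨α₁, hα₁l, hα₁r⟩ := exists_rat_btwn (show x₁ - ε / 2 < x₁ by linarith)
  obtain ⟨β₁, hβ₁l, hβ₁r⟩ := exists_rat_btwn (show x₁ < x₁ + ε / 2 by linarith)
  have hIball : ∀ t ∈ Icc (α₁ : ℝ) β₁, dist t x₁ < ε := fun t ht => by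
    rw [Real.dist_eq, abs_lt]
    constructor <;> linarith [ht.1, ht.2]
  have hgood : ∀ t ∈ Icc (α₁ : ℝ) β₁, B t ≠ 0 ∧ t ∈ Ioo α β := fun t ht => hball (hIball t ht)
  have hα₁β₁ : (α₁ : ℝ) < β₁ := by linarith
  -- on it `φ = −A/B` is continuous and a.e. equal to `1/x`, hence equal everywhere
  set ψ : ℝ → ℝ := fun t => -A t / B t with hψ
  have hφψ : ∀ t ∈ Ioo (α₁ : ℝ) β₁, φ t = ψ t := by
    intro t ht
    have hg := hgood t (Ioo_subset_Icc_self ht)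
    have := hident t hg.2
    rw [hψ]
    field_simp [hg.1]
    linarith
  have hsubI : Ioo (α₁ : ℝ) β₁ ⊆ Ioo α β := fun t ht => (hgood t (Ioo_subset_Icc_self ht)).2
  have hψcont : ContinuousOn ψ (Ioo (α₁ : ℝ) β₁) :=
    ((hAcont.mono hsubI).neg).div (hBcont.mono hsubI)
      fun t ht => (hgood t (Ioo_subset_Icc_self ht)).1
  have hinvcont : ContinuousOn (fun t : ℝ => 1 / t) (Ioo (α₁ : ℝ) β₁) :=
    continuousOn_const.div continuousOn_id fun t ht => (h0.trans (hsubI ht).1).ne'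
  have haeI : ψ =ᵐ[volume.restrict (Ioo (α₁ : ℝ) β₁)] fun t => 1 / t := by
    rw [Filter.EventuallyEq, ae_restrict_iff' measurableSet_Ioo]
    filter_upwards [hae] with t ht htI
    rw [← hφψ t htI]
    exact ht (hsubI htI)
  have heq : EqOn ψ (fun t : ℝ => 1 / t) (Ioo (α₁ : ℝ) β₁) :=
    Measure.eqOn_open_of_ae_eq haeI isOpen_Ioo hψcont hinvcont
  refine ⟨α₁, β₁, (hgood α₁ ⟨le_rfl, hα₁β₁.le⟩).2.1, by exact_mod_cast hα₁β₁,
    (hgood β₁ ⟨hα₁β₁.le, le_rfl⟩).2.2, fun x hx => ?_⟩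
  have := hderiv x (hsubI hx)
  rwa [hφψ x hx, heq hx] at this

/-- **Affine transport of semialgebraicity**: `u ↦ G(α + ℓ u)` is `ℚ`-semialgebraic on `[0,1]`
when `G` is on `[α, α + ℓ]` (`ℓ > 0`, rational data): its graph is the preimage of the graph of
`G` under the polynomial map `(u, y) ↦ (α + ℓ u, y)`. [folklore] -/
theorem isSemialgebraicFunOn_affine {α ℓ : ℚ} (hℓ : 0 < ℓ) {G : (Fin 1 → ℝ) → ℝ}
    (hG : IsSemialgebraicFunOn ℚ {z : Fin 1 → ℝ | (α : ℝ) ≤ z 0 ∧ z 0 ≤ (α : ℝ) + ℓ} G) :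
    IsSemialgebraicFunOn ℚ {x : Fin 1 → ℝ | x 0 ∈ Icc (0 : ℝ) 1}
      (fun u : Fin 1 → ℝ => G (fun _ => (α : ℝ) + (ℓ : ℝ) * u 0)) := by
  rw [isSemialgebraicFunOn_iff] at hG ⊢
  set T : Fin 2 → MvPolynomial (Fin 2) ℚ :=
    ![MvPolynomial.C α + MvPolynomial.C ℓ * MvPolynomial.X 0, MvPolynomial.X 1] with hT
  have hpre := hG.preimage_aeval T
  convert hpre using 1
  ext w
  have hinit : ∀ z : Fin 2 → ℝ, (Fin.init z : Fin 1 → ℝ) = fun _ => z 0 := fun z => by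
    funext i; rw [Fin.fin_one_eq_zero i]; rfl
  have hℓ' : (0 : ℝ) < ℓ := by exact_mod_cast hℓ
  simp only [mem_setOf_eq, mem_preimage, hinit, mem_Icc, hT]
  simp only [Fin.isValue, Matrix.cons_val_zero, map_add, MvPolynomial.aeval_C,
    map_mul, MvPolynomial.aeval_X, eq_ratCast]
  constructor
  · rintro ⟨⟨h0, h1⟩, h2⟩
    refine ⟨⟨by nlinarith, by nlinarith⟩, ?_⟩
    simpa [Fin.last] using h2
  · rintro ⟨⟨h0, h1⟩, h2⟩
    refine ⟨⟨by nlinarith, by nlinarith⟩, ?_⟩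
    simpa [Fin.last] using h2

/-- **(C) Exact primitives: the barrier.** No `ℚ`-semialgebraic `G` on a rational strip
`{α₁ ≤ z₀ ≤ β₁}` with `0 < α₁ < β₁` has derivative EXACTLY `1/x` on `(α₁, β₁)`: transport to
`[0,1]` by `u ↦ α₁ + (β₁ − α₁)u`, where the derivative becomes `1/(u − x₀)` with
`x₀ = −α₁/(β₁ − α₁) < 0`, and apply the algebraic core of the barrier
(`NoSemialgPrimKernel.exists_ne_zero_evalEval_eq_zero` + `eq_zero_of_evalEval_eq_zero` with
`V = N = 1`). [folklore] -/
theorem no_semialgebraic_primitive_inv {α₁ β₁ : ℚ} (h0 : 0 < α₁) (hαβ : α₁ < β₁)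
    {G : (Fin 1 → ℝ) → ℝ}
    (hG : IsSemialgebraicFunOn ℚ {z : Fin 1 → ℝ | (α₁ : ℝ) ≤ z 0 ∧ z 0 ≤ (β₁ : ℝ)} G)
    (hderiv : ∀ x ∈ Ioo (α₁ : ℝ) β₁, HasDerivAt (fun s : ℝ => G (fun _ => s)) (1 / x) x) :
    False := by
  set ℓ : ℚ := β₁ - α₁ with hℓ
  have hℓ0 : 0 < ℓ := by rw [hℓ]; linarith
  have hℓ0' : (0 : ℝ) < ℓ := by exact_mod_cast hℓ0
  have hα0' : (0 : ℝ) < α₁ := by exact_mod_cast h0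
  have hG' : IsSemialgebraicFunOn ℚ {z : Fin 1 → ℝ | (α₁ : ℝ) ≤ z 0 ∧ z 0 ≤ (α₁ : ℝ) + ℓ} G := by
    convert hG using 3
    push_cast [hℓ]
    ring_nf
  have hG₁ := isSemialgebraicFunOn_affine hℓ0 hG'
  set g₁ : ℝ → ℝ := fun u => G (fun _ => (α₁ : ℝ) + (ℓ : ℝ) * u) with hg₁
  obtain ⟨P₁, hP₁0, hP₁v⟩ :=
    Literature.Barriers.KontsevichZagierPeriods.KZ.NoSemialgPrimKernel.exists_ne_zero_evalEval_eq_zero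
      hG₁
  -- the transported derivative
  have hderiv₁ : ∀ u ∈ Ioo (0 : ℝ) 1,
      HasDerivAt g₁ (1 / ((α₁ : ℝ) + (ℓ : ℝ) * u) * (ℓ : ℝ)) u := by
    intro u hu
    have hx : (α₁ : ℝ) + (ℓ : ℝ) * u ∈ Ioo (α₁ : ℝ) β₁ := by
      constructor
      · nlinarith [hu.1]
      · have : (β₁ : ℝ) = α₁ + ℓ := by push_cast [hℓ]; ring
        rw [this]; nlinarith [hu.2]
    have haff : HasDerivAt (fun u : ℝ => (α₁ : ℝ) + (ℓ : ℝ) * u) (ℓ : ℝ) u := by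
      simpa using ((hasDerivAt_id u).const_mul (ℓ : ℝ)).const_add (α₁ : ℝ)
    exact (hderiv _ hx).comp u haff
  set x₀ : ℝ := -(α₁ : ℝ) / ℓ with hx₀
  have hDN : ∀ u ∈ Ioo (0 : ℝ) 1,
      ((X - C x₀) * 1 : ℝ[X]).eval u * (1 / ((α₁ : ℝ) + (ℓ : ℝ) * u) * (ℓ : ℝ)) =
        (1 : ℝ[X]).eval u := by
    intro u hu
    have hpos : (0 : ℝ) < (α₁ : ℝ) + (ℓ : ℝ) * u := by nlinarith [hu.1]
    have hne : (α₁ : ℝ) + (ℓ : ℝ) * u ≠ 0 := hpos.ne'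
    have hℓne : (ℓ : ℝ) ≠ 0 := hℓ0'.ne'
    simp only [mul_one, eval_sub, eval_X, eval_C, eval_one, hx₀]
    rw [show u - -(α₁ : ℝ) / ℓ = ((α₁ : ℝ) + (ℓ : ℝ) * u) / ℓ by field_simp; ring]
    rw [div_mul_eq_mul_div, one_div, ← mul_assoc, mul_inv_cancel₀ hne, one_mul, div_self hℓne]
  have key := Literature.Barriers.KontsevichZagierPeriods.KZ.NoSemialgPrimKernel.eq_zero_of_evalEval_eq_zero
    (G := g₁) (V := 1) (N := 1) (x₀ := x₀) hderiv₁ hDN (by simp) (by simp)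
    P₁.natDegree P₁ le_rfl (fun u hu => hP₁v u (Ioo_subset_Icc_self hu))
  exact hP₁0 key

/-- **Heart.** On a rational interval `[α, β] ⊂ (0, ∞)`, no `ℚ`-semialgebraic `G` (on the strip
`{α ≤ z₀ ≤ β} ⊆ ℝ¹`) has on `(α, β)` a derivative `φ` equal to `1/x` ALMOST everywhere:
(A) polynomial relation, (B) upgrade to an exact derivative on a rational subinterval,
(C) the barrier. [folklore] -/
theorem no_semialgebraic_ae_primitive_inv {α β : ℚ} (h0 : 0 < α) (hαβ : α < β)
    {G : (Fin 1 → ℝ) → ℝ} {φ : ℝ → ℝ}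
    (hG : IsSemialgebraicFunOn ℚ {z : Fin 1 → ℝ | (α : ℝ) ≤ z 0 ∧ z 0 ≤ (β : ℝ)} G)
    (hderiv : ∀ x ∈ Ioo (α : ℝ) β, HasDerivAt (fun s : ℝ => G (fun _ => s)) (φ x) x)
    (hae : ∀ᵐ x, x ∈ Ioo (α : ℝ) β → φ x = 1 / x) : False := by
  have h0' : (0 : ℝ) < α := by exact_mod_cast h0
  have hαβ' : (α : ℝ) < β := by exact_mod_cast hαβ
  obtain ⟨P, hP0, hPv⟩ := exists_polyRel hG
  obtain ⟨α₁, β₁, hαα₁, hα₁β₁, hβ₁β, hexact⟩ := upgrade_ae_deriv h0' hαβ' hderiv hae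
    ⟨P, hP0, fun t ht => hPv t (Ioo_subset_Icc_self ht)⟩
  have hα₁0 : 0 < α₁ := by exact_mod_cast h0'.trans hαα₁
  have hsub : {z : Fin 1 → ℝ | (α₁ : ℝ) ≤ z 0 ∧ z 0 ≤ (β₁ : ℝ)} ⊆
      {z : Fin 1 → ℝ | (α : ℝ) ≤ z 0 ∧ z 0 ≤ (β : ℝ)} := fun z hz =>
    ⟨hαα₁.le.trans hz.1, hz.2.trans hβ₁β.le⟩
  exact no_semialgebraic_primitive_inv hα₁0 hα₁β₁ (hG.mono hsub (isSemialgebraic_strip α₁ β₁))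
    hexact

end Heart

/-! ## §7 Extraction and the load-bearing theorem -/

/-- A rational closed interval inside `(1,2)` avoiding a given finite set. [folklore] -/
theorem exists_rat_Icc_avoiding (P : Finset ℝ) :
    ∃ α β : ℚ, (1 : ℝ) < α ∧ α < β ∧ (β : ℝ) < 2 ∧ ∀ p ∈ P, p ∉ Icc (α : ℝ) β := by
  -- the complement of `P` in `(1,2)` is open and non-empty
  have hopen : IsOpen (Ioo (1 : ℝ) 2 \ (P : Set ℝ)) := isOpen_Ioo.sdiff P.finite_toSet.isClosed
  have hne : (Ioo (1 : ℝ) 2 \ (P : Set ℝ)).Nonempty := by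
    by_contra h
    have hsub : Ioo (1 : ℝ) 2 ⊆ (P : Set ℝ) := fun y hy => by
      by_contra hyP
      exact h ⟨y, hy, hyP⟩
    exact (Ioo_infinite (by norm_num : (1 : ℝ) < 2)) (P.finite_toSet.subset hsub)
  obtain ⟨x, hx⟩ := hne
  obtain ⟨ε, hε, hball⟩ := Metric.isOpen_iff.mp hopen x hx
  obtain ⟨α, hα₁, hα₂⟩ := exists_rat_btwn (show x - ε / 2 < x by linarith)
  obtain ⟨β, hβ₁, hβ₂⟩ := exists_rat_btwn (show x < x + ε / 2 by linarith)
  have hsub : Icc (α : ℝ) β ⊆ Ioo (1 : ℝ) 2 \ (P : Set ℝ) := by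
    intro y hy
    apply hball
    rw [Metric.mem_ball, Real.dist_eq, abs_lt]
    constructor <;> linarith [hy.1, hy.2]
  refine ⟨α, β, (hsub ⟨le_rfl, by exact_mod_cast (show (α : ℝ) ≤ β by linarith)⟩).1.1,
    by exact_mod_cast (show (α : ℝ) < β by linarith),
    (hsub ⟨by exact_mod_cast (show (α : ℝ) ≤ β by linarith), le_rfl⟩).1.2, fun p hp hpI => ?_⟩
  exact (hsub hpI).2 hp

/-- Interval dichotomy: if neither endpoint of `[a,b]` lies in `[α,β]`, then `[α,β]` is either
inside `(a,b)` or disjoint from `[a,b]`. [folklore] -/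
theorem Icc_subset_Ioo_or_disjoint {α β a b : ℝ} (ha : a ∉ Icc α β) (hb : b ∉ Icc α β) :
    Icc α β ⊆ Ioo a b ∨ ∀ s ∈ Icc α β, s ∉ Icc a b := by
  by_cases h : ∃ s ∈ Icc α β, s ∈ Icc a b
  · obtain ⟨s, hs, hsab⟩ := h
    left
    have ha' : a < α := by
      rcases lt_or_ge a α with h' | h'
      · exact h'
      · exact absurd ⟨h', hsab.1.trans hs.2⟩ ha
    have hb' : β < b := by
      rcases lt_or_ge β b with h' | h'
      · exact h'
      · exact absurd ⟨hs.1.trans hsab.2, h'⟩ hb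
    intro y hy
    exact ⟨ha'.trans_le hy.1, hy.2.trans_lt hb'⟩
  · right
    push Not at h
    exact h

/-- Integer combinations of `ℚ`-semialgebraic functions are `ℚ`-semialgebraic
(`IsSemialgebraicFunOn.add_holds`, `mul_holds`, constants are polynomials). [folklore] -/
theorem isSemialgebraicFunOn_zsum {ι : Type*} (T : Finset ι) {s : Set (Fin 1 → ℝ)}
    (hs : Literature.ModelTheory.ExponentialFields.IsSemialgebraic ℚ s) (coef : ι → ℤ)
    (F : ι → (Fin 1 → ℝ) → ℝ) (hF : ∀ i ∈ T, IsSemialgebraicFunOn ℚ s (F i)) :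
    IsSemialgebraicFunOn ℚ s (fun z => ∑ i ∈ T, (coef i : ℝ) * F i z) := by
  classical
  induction T using Finset.induction_on with
  | empty =>
    refine (isSemialgebraicFunOn_aeval hs (0 : MvPolynomial (Fin 1) ℚ)).congr ?_
    intro z _; simp
  | insert j T hj ih =>
    have hFj : IsSemialgebraicFunOn ℚ s (F j) := hF j (Finset.mem_insert_self j T)
    have hterm : IsSemialgebraicFunOn ℚ s (fun z => (coef j : ℝ) * F j z) := by
      have hc := isSemialgebraicFunOn_aeval hs (MvPolynomial.C (coef j : ℚ) : MvPolynomial (Fin 1) ℚ)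
      have := IsSemialgebraicFunOn.mul_holds hc hFj
      refine this.congr fun z _ => ?_
      simp
    have := IsSemialgebraicFunOn.add_holds hterm (ih fun i hi => hF i (Finset.mem_insert_of_mem hi))
    refine this.congr fun z _ => ?_
    simp [Finset.sum_insert hj]

/-- **Core of the refutation.** For the witness `r₀ = [(1,2), 1/x]` and ANY `c` in the word
closure, `[r₀] − c ∉ relationsWithoutCoV`: the slice density class `D` is an invariant of
`relationsWithoutCoV`; `D ([r₀] − c) = 0` would make `1/x` almost everywhere on `(1,2)` an exact
`ℚ`-semialgebraic density plus word slices (which vanish off `(0,1)`), and on a rational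
subinterval avoiding the finitely many band endpoints this contradicts
`no_semialgebraic_ae_primitive_inv`. [folklore] -/
theorem of_r₀_sub_not_mem_relationsWithoutCoV {c : KZ.FormalRep}
    (hc : c ∈ AddSubgroup.closure wordReps) : KZ.of r₀ - c ∉ relationsWithoutCoV := by
  classical
  intro hrel
  have hD : D (KZ.of r₀ - c) = 0 := relationsWithoutCoV_le_ker_D hrel
  rw [D_eq_zero_iff, map_sub, sliceFun_of_succ] at hD
  obtain ⟨h, hh, w, hw, hsum⟩ := AddSubgroup.mem_sup.mp hD
  rw [← Submodule.span_int_eq_addSubgroupClosure, Submodule.mem_toAddSubgroup,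
    Submodule.mem_span_set'] at hw
  obtain ⟨N, coef, gen, hw⟩ := hw
  have hgen : ∀ i, ∃ (a b : ℝ) (f : ℝ → ℝ) (F : (Fin 1 → ℝ) → ℝ), a ≤ b ∧
      IsSemialgebraicFunOn ℚ {z : Fin 1 → ℝ | a ≤ z 0 ∧ z 0 ≤ b} F ∧
      (∀ t ∈ Ioo a b, HasDerivAt (fun s : ℝ => F (fun _ => s)) (f t) t) ∧
      ((gen i : ℝ → ℝ)) = (Icc a b).indicator f := fun i => (gen i).2
  choose a b f F hab hF hderiv hgen using hgen
  -- the a.e. identity on `(1,2)`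
  have hae : ∀ᵐ s, s ∈ Ioo (1 : ℝ) 2 → w s = 1 / s := by
    have hh' : h =ᵐ[volume] 0 := hh
    filter_upwards [hh'] with s hs h12
    have hns : s ∉ Ioo (0 : ℝ) 1 := fun h' => by linarith [h'.2, h12.1]
    have hpt := congrFun hsum s
    simp only [Pi.add_apply, Pi.sub_apply, hs, Pi.zero_apply, zero_add, slice_r₀,
      indicator_of_mem h12, sliceFun_eq_zero_of_not_mem hc hns, sub_zero] at hpt
    exact hpt
  have hw_apply : ∀ s, w s = ∑ i, (coef i : ℝ) * (Icc (a i) (b i)).indicator (f i) s := by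
    intro s
    rw [← hw, Finset.sum_apply]
    refine Finset.sum_congr rfl fun i _ => ?_
    rw [← hgen i]
    simp [zsmul_eq_mul]
  -- a rational interval avoiding all endpoints
  obtain ⟨α, β, h1α, hαβ, hβ2, havoid⟩ :=
    exists_rat_Icc_avoiding (Finset.univ.image a ∪ Finset.univ.image b)
  have hαβ' : (α : ℝ) ≤ β := by exact_mod_cast hαβ.le
  have ha' : ∀ i, a i ∉ Icc (α : ℝ) β := fun i =>
    havoid _ (Finset.mem_union_left _ (Finset.mem_image_of_mem a (Finset.mem_univ i)))
  have hb' : ∀ i, b i ∉ Icc (α : ℝ) β := fun i =>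
    havoid _ (Finset.mem_union_right _ (Finset.mem_image_of_mem b (Finset.mem_univ i)))
  set Act : Finset (Fin N) := Finset.univ.filter fun i => Icc (α : ℝ) β ⊆ Ioo (a i) (b i) with hAct
  have hAct_mem : ∀ i ∈ Act, Icc (α : ℝ) β ⊆ Ioo (a i) (b i) := fun i hi => by
    simpa [hAct] using hi
  have hdich : ∀ i, ∀ s ∈ Icc (α : ℝ) β,
      (Icc (a i) (b i)).indicator (f i) s = if i ∈ Act then f i s else 0 := by
    intro i s hs
    rcases Icc_subset_Ioo_or_disjoint (ha' i) (hb' i) with hin | hout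
    · have hi : i ∈ Act := by simp [hAct, hin]
      rw [if_pos hi, indicator_of_mem (Ioo_subset_Icc_self (hin hs))]
    · have hi : i ∉ Act := by
        simp only [hAct, Finset.mem_filter, Finset.mem_univ, true_and]
        intro hin
        exact hout _ hs (Ioo_subset_Icc_self (hin hs))
      rw [if_neg hi, indicator_of_notMem (hout s hs)]
  -- the combination `G` of the active primitives and its derivative `φ`
  set G : (Fin 1 → ℝ) → ℝ := fun z => ∑ i ∈ Act, (coef i : ℝ) * F i z with hG
  set φ : ℝ → ℝ := fun s => ∑ i ∈ Act, (coef i : ℝ) * f i s with hφ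
  have hstrip := isSemialgebraic_strip α β
  have hGsa : IsSemialgebraicFunOn ℚ {z : Fin 1 → ℝ | (α : ℝ) ≤ z 0 ∧ z 0 ≤ (β : ℝ)} G := by
    refine isSemialgebraicFunOn_zsum Act hstrip coef F fun i hi => (hF i).mono ?_ hstrip
    intro z hz
    have := hAct_mem i hi ⟨hz.1, hz.2⟩
    exact ⟨this.1.le, this.2.le⟩
  have hGderiv : ∀ x ∈ Ioo (α : ℝ) β, HasDerivAt (fun s : ℝ => G (fun _ => s)) (φ x) x := by
    intro x hx
    have : HasDerivAt (fun s : ℝ => ∑ i ∈ Act, (coef i : ℝ) * F i (fun _ => s))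
        (∑ i ∈ Act, (coef i : ℝ) * f i x) x :=
      HasDerivAt.fun_sum fun i hi =>
        (hderiv i x (hAct_mem i hi (Ioo_subset_Icc_self hx))).const_mul _
    exact this
  have hGae : ∀ᵐ x, x ∈ Ioo (α : ℝ) β → φ x = 1 / x := by
    filter_upwards [hae] with s hs hsI
    have h12 : s ∈ Ioo (1 : ℝ) 2 := ⟨h1α.trans hsI.1, hsI.2.trans hβ2⟩
    have hsIcc : s ∈ Icc (α : ℝ) β := Ioo_subset_Icc_self hsI
    rw [← hs h12, hw_apply s]
    rw [show (∑ i, (coef i : ℝ) * (Icc (a i) (b i)).indicator (f i) s) =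
        ∑ i, (if i ∈ Act then (coef i : ℝ) * f i s else 0) from
      Finset.sum_congr rfl fun i _ => by rw [hdich i s hsIcc]; split_ifs <;> simp]
    rw [← Finset.sum_filter]
    simp [hφ, hAct]
  exact no_semialgebraic_ae_primitive_inv (zero_lt_one.trans (by exact_mod_cast h1α)) hαβ
    hGsa hGderiv hGae


/-- **LOAD-BEARING (rule 2): `ArrangementNormalForm` is FALSE for the calculus without the
change-of-variables move** — the crux with `KZ.relations` replaced by `relationsWithoutCoV`
(rules (1a), (1b), (3) only), stated inline; witness `r₀ = [(1,2), 1/x]`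
(`of_r₀_sub_not_mem_relationsWithoutCoV`). Hence any proof of the crux must use rule (2)
(already to move the cell `(1,2)` onto the simplex `(0,1)`). [folklore] -/
theorem arrangementNormalForm_false_without_changeOfVariables :
    ¬ ∀ (n m m' : ℕ) (r : KZ.IntegralRep n) (M : Fin m' → (Fin n → ℚ) × ℚ)
        (L : Fin m → (Fin n → ℚ) × ℚ) (e : Fin m → ℕ) (p : MvPolynomial (Fin n) ℚ),
      r.domain = {x | ∀ j, 0 < ∑ i, ((M j).1 i : ℝ) * x i + ((M j).2 : ℝ)} →
      EqOn r.integrand (fun x => MvPolynomial.aeval x p /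
        ∏ j, (∑ i, ((L j).1 i : ℝ) * x i + ((L j).2 : ℝ)) ^ e j) r.domain →
      ∃ c ∈ AddSubgroup.closure wordReps, KZ.of r - c ∈ relationsWithoutCoV := by
  intro H
  obtain ⟨c, hc, hrel⟩ := H 1 1 2 r₀ cellRows lineRows (fun _ => 1) 1 rfl r₀_eqOn
  exact of_r₀_sub_not_mem_relationsWithoutCoV hc hrel

/-! ## §8 Corollary: rule (2) is independent of rules (1), (3) even on equal-value RATIONAL pairs -/

/-- The one-dimensional open simplex `(0,1) ⊂ ℝ¹` has finite volume. [folklore] -/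
theorem volume_simplex_one_lt_top :
    volume {t : Fin 1 → ℝ | (∀ i, 0 < t i) ∧ (∀ i, t i < 1) ∧ StrictAnti t} < ⊤ := by
  have hset : {t : Fin 1 → ℝ | (∀ i, 0 < t i) ∧ (∀ i, t i < 1) ∧ StrictAnti t} =
      (MeasurableEquiv.funUnique (Fin 1) ℝ) ⁻¹' Ioo 0 1 := by
    ext t
    have he : (MeasurableEquiv.funUnique (Fin 1) ℝ) t = t 0 := rfl
    simp only [mem_setOf_eq, mem_preimage, mem_Ioo, Fin.forall_fin_one, he]
    exact ⟨fun h => ⟨h.1, h.2.1⟩, fun h => ⟨h.1, h.2, Subsingleton.strictAnti _⟩⟩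
  rw [hset]
  have h := (volume_preserving_funUnique (Fin 1) ℝ).measure_preimage
    (s := Ioo (0 : ℝ) 1) measurableSet_Ioo.nullMeasurableSet
  exact h.trans_lt (by simp)

/-- **The word** `s₁ = [(0,1), 1/(t+1)]` (letter `a = −1`, `q = 1`; value `log 2`) as a rational
representation. [folklore] -/
def s₁ : KZ.IntegralRep 1 :=
  KZ.IntegralRep.ofRational {t : Fin 1 → ℝ | (∀ i, 0 < t i) ∧ (∀ i, t i < 1) ∧ StrictAnti t}
    1 (MvPolynomial.X 0 + 1) (KZ.isSemialgebraic_openOrderedSimplex 1)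
    (fun t ht => by
      have h0 : 0 < t 0 := ht.1 0
      simp only [map_add, MvPolynomial.aeval_X, map_one, ne_eq]
      linarith)
    (by
      have hmeas : MeasurableSet {t : Fin 1 → ℝ | (∀ i, 0 < t i) ∧ (∀ i, t i < 1) ∧ StrictAnti t} :=
        KZ.measurableSet_openOrderedSimplex 1
      have hcont : ContinuousOn (fun t : Fin 1 → ℝ =>
          MvPolynomial.aeval t (1 : MvPolynomial (Fin 1) ℚ) /
            MvPolynomial.aeval t (MvPolynomial.X 0 + 1 : MvPolynomial (Fin 1) ℚ))
          {t : Fin 1 → ℝ | (∀ i, 0 < t i) ∧ (∀ i, t i < 1) ∧ StrictAnti t} := by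
        refine ContinuousOn.div ((continuousOn_const (c := (1 : ℝ))).congr fun x _ => by simp) ?_
          fun t ht => ?_
        · have : Continuous fun t : Fin 1 → ℝ => t 0 + 1 := (continuous_apply 0).add continuous_const
          simpa using this.continuousOn
        · have h0 : 0 < t 0 := ht.1 0
          simp only [map_add, MvPolynomial.aeval_X, map_one, ne_eq]
          linarith
      refine IntegrableOn.of_bound volume_simplex_one_lt_top (hcont.aestronglyMeasurable hmeas) 1 ?_
      rw [ae_restrict_iff' hmeas]
      refine Filter.Eventually.of_forall fun t ht => ?_
      have h0 : 0 < t 0 := ht.1 0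
      simp only [map_one, map_add, MvPolynomial.aeval_X]
      rw [Real.norm_eq_abs, abs_of_pos (by positivity), div_le_one (by linarith)]
      linarith)

/-- `s₁` is a generator of the word class (`w = 1`, `a₀ = −1`, `q = 1`). [folklore] -/
theorem of_s₁_mem_wordReps : KZ.of s₁ ∈ wordReps := by
  refine ⟨1, fun _ => -1, 1, s₁, rfl, fun t _ => ?_, rfl⟩
  simp [s₁, sub_neg_eq_add, add_comm]

/-- `∫₁² dx/x = log 2`. [folklore] -/
theorem r₀_value : r₀.value = Real.log 2 := by
  unfold KZ.IntegralRep.value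
  rw [r₀_integrand, r₀_domain, cell_eq_preimage]
  have h : ∫ x in (MeasurableEquiv.funUnique (Fin 1) ℝ) ⁻¹' Ioo 1 2, 1 / x 0 =
      ∫ y in Ioo (1 : ℝ) 2, 1 / y :=
    (volume_preserving_funUnique (Fin 1) ℝ).setIntegral_preimage_emb
      (MeasurableEquiv.funUnique (Fin 1) ℝ).measurableEmbedding (fun y : ℝ => 1 / y) (Ioo 1 2)
  simp only []
  rw [h, ← integral_Ioc_eq_integral_Ioo, ← intervalIntegral.integral_of_le one_le_two]
  simp only [one_div]
  rw [integral_inv (by norm_num [mem_uIcc])]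
  norm_num

/-- `∫₀¹ dt/(t+1) = log 2`. [folklore] -/
theorem s₁_value : s₁.value = Real.log 2 := by
  have hset : {t : Fin 1 → ℝ | (∀ i, 0 < t i) ∧ (∀ i, t i < 1) ∧ StrictAnti t} =
      (MeasurableEquiv.funUnique (Fin 1) ℝ) ⁻¹' Ioo 0 1 := by
    ext t
    have he : (MeasurableEquiv.funUnique (Fin 1) ℝ) t = t 0 := rfl
    simp only [mem_setOf_eq, mem_preimage, mem_Ioo, Fin.forall_fin_one, he]
    exact ⟨fun h => ⟨h.1, h.2.1⟩, fun h => ⟨h.1, h.2, Subsingleton.strictAnti _⟩⟩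
  have hint : s₁.integrand = fun t => 1 / (t 0 + 1) := by
    ext t; simp [s₁]
  have hdom : s₁.domain = {t : Fin 1 → ℝ | (∀ i, 0 < t i) ∧ (∀ i, t i < 1) ∧ StrictAnti t} := rfl
  unfold KZ.IntegralRep.value
  rw [hint, hdom, hset]
  have h : ∫ x in (MeasurableEquiv.funUnique (Fin 1) ℝ) ⁻¹' Ioo 0 1, 1 / (x 0 + 1) =
      ∫ y in Ioo (0 : ℝ) 1, 1 / (y + 1) :=
    (volume_preserving_funUnique (Fin 1) ℝ).setIntegral_preimage_emb
      (MeasurableEquiv.funUnique (Fin 1) ℝ).measurableEmbedding (fun y : ℝ => 1 / (y + 1)) (Ioo 0 1)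
  simp only []
  rw [h, ← integral_Ioc_eq_integral_Ioo, ← intervalIntegral.integral_of_le zero_le_one]
  simp only [one_div]
  rw [intervalIntegral.integral_comp_add_right (fun y : ℝ => y⁻¹) 1,
    integral_inv (by norm_num [mem_uIcc])]
  norm_num

/-- **Rule (2) is independent of rules (1a), (1b), (3) — even for equal-value RATIONAL pairs.**
The rational representations `r₀ = [(1,2), 1/x]` and `s₁ = [(0,1), 1/(t+1)]` have the same value
`log 2` (in the full calculus they differ by ONE change of variables, the translation
`t ↦ t + 1`), but `[r₀] − [s₁] ∉ relationsWithoutCoV`: Kontsevich–Zagier's Conjecture 1 is FALSE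
for the calculus of rules (1) and (3) alone. [folklore] -/
theorem kzConjecture_false_without_changeOfVariables :
    r₀.IsRational ∧ s₁.IsRational ∧ r₀.value = s₁.value ∧
      KZ.of r₀ - KZ.of s₁ ∉ relationsWithoutCoV :=
  ⟨KZ.IntegralRep.isRational_ofRational _ _ _ _ _ _, KZ.IntegralRep.isRational_ofRational _ _ _ _ _ _,
    by rw [r₀_value, s₁_value],
    of_r₀_sub_not_mem_relationsWithoutCoV (AddSubgroup.subset_closure of_s₁_mem_wordReps)⟩

end Summit.KontsevichZagierPeriods.ArrangementNormalForm.NoCoV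

/-! ## §11 TIGHTNESS in every weight: word representations are admissible
(also attached separately as `WordTight.lean`)

A hyperlogarithm word representation `[Δ_w, q · ∏ᵢ 1/(tᵢ − aᵢ)]` typed as a `KZ.IntegralRep w`
(hence ABSOLUTELY convergent) with `q ≠ 0` has an ADMISSIBLE word: no letter inside `(0,1)`, first
letter `a₀ ≠ 1`, last letter `a_{w−1} ≠ 0` (`wordRep_admissible`). Together with the existence
theorem for admissible words (disprover's `WordReps.exists_wordRep`) this pins the target class of
`ArrangementNormalForm` / `DihedralNormalForm` / `MzvKernelInKZ` exactly: generators with `q ≠ 0`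
are precisely the admissible rational words. Proof: around a bad letter `aᵢ ∈ [0,1]` the open
simplex contains an adapted grid BOX `∏ⱼ (lⱼ, uⱼ)` with `aᵢ ∈ [lᵢ, uᵢ]`; on it the integrand
dominates `C·|tᵢ − aᵢ|⁻¹` (a.e., off the hyperplanes `tⱼ = aⱼ`), whose marginal in the `i`-th
coordinate (`Measure.pi_map_eval`) is `(x − aᵢ)⁻¹` on `(lᵢ, uᵢ)`, not integrable
(`intervalIntegrable_sub_inv_iff`). [Kontsevich–Zagier 2001, §1.1; Brown 2009 (convergence of
hyperlogarithms)]
-/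

namespace Summit.KontsevichZagierPeriods.ArrangementNormalForm.WordTight

open MeasureTheory Set
open Literature.NumberTheory.Transcendental

/-! ## The analytic lemma: a box marginal -/

/-- **Box marginal.** On an open box `∏ⱼ (lⱼ, uⱼ)`, no integrable `f` dominates `C·|tᵢ − A|⁻¹`
almost everywhere when `A ∈ [lᵢ, uᵢ]`: the `i`-th marginal of `|tᵢ − A|⁻¹` is a positive multiple
of `(x − A)⁻¹` on `(lᵢ, uᵢ)`, which is not integrable. [folklore] -/
theorem false_of_inv_le {n : ℕ} (l u : Fin (n + 1) → ℝ) (hlu : ∀ j, l j < u j) (i : Fin (n + 1))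
    {A C : ℝ} (hA : A ∈ Icc (l i) (u i)) (hC : 0 < C) {f : (Fin (n + 1) → ℝ) → ℝ}
    (hf : IntegrableOn f (Set.pi univ fun j => Ioo (l j) (u j)))
    (hbound : ∀ᵐ t ∂(volume.restrict (Set.pi univ fun j => Ioo (l j) (u j))),
      C * |t i - A|⁻¹ ≤ ‖f t‖) : False := by
  classical
  set box : Set (Fin (n + 1) → ℝ) := Set.pi univ fun j => Ioo (l j) (u j) with hbox
  -- `(t i − A)⁻¹` is integrable on the box
  have hg : IntegrableOn (fun t : Fin (n + 1) → ℝ => (t i - A)⁻¹) box := by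
    have h1 : IntegrableOn (fun t => C⁻¹ * ‖f t‖) box := hf.norm.const_mul _
    refine Integrable.mono' h1
      ((show Measurable (fun t : Fin (n + 1) → ℝ => (t i - A)⁻¹) by fun_prop).aestronglyMeasurable) ?_
    filter_upwards [hbound] with t ht
    rw [Real.norm_eq_abs, abs_inv, le_inv_mul_iff₀ hC]
    exact ht
  -- pass to the product of restricted measures and take the `i`-th marginal
  have hvol : (volume : Measure (Fin (n + 1) → ℝ)).restrict box =
      Measure.pi fun j => (volume : Measure ℝ).restrict (Ioo (l j) (u j)) := by
    rw [hbox, volume_pi, Measure.restrict_pi_pi]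
  have hgi : Integrable ((fun x : ℝ => (x - A)⁻¹) ∘ Function.eval i)
      (Measure.pi fun j => (volume : Measure ℝ).restrict (Ioo (l j) (u j))) := by
    rw [← hvol]
    exact hg
  have hgm : Measurable (fun x : ℝ => (x - A)⁻¹) := by fun_prop
  rw [← integrable_map_measure hgm.aestronglyMeasurable (measurable_pi_apply i).aemeasurable,
    Measure.pi_map_eval] at hgi
  have hc0 : (∏ j ∈ Finset.univ.erase i,
      ((fun j => (volume : Measure ℝ).restrict (Ioo (l j) (u j))) j) univ) ≠ 0 := by
    rw [Finset.prod_ne_zero_iff]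
    intro j _
    simp [(hlu j)]
  have hctop : (∏ j ∈ Finset.univ.erase i,
      ((fun j => (volume : Measure ℝ).restrict (Ioo (l j) (u j))) j) univ) ≠ ⊤ := by
    refine ENNReal.prod_ne_top fun j _ => ?_
    simp
  rw [integrable_smul_measure hc0 hctop] at hgi
  have hii : IntervalIntegrable (fun x : ℝ => (x - A)⁻¹) volume (l i) (u i) :=
    (intervalIntegrable_iff_integrableOn_Ioo_of_le (hlu i).le).mpr hgi
  rcases intervalIntegrable_sub_inv_iff.mp hii with h | h
  · exact (hlu i).ne h
  · exact h (by rw [uIcc_of_le (hlu i).le]; exact hA)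

/-! ## The adapted grid box around a bad letter -/

variable {n : ℕ}

/-- Lower ends of the adapted grid box (weight `w = n + 1`, bad index `i`, pivot `A = aᵢ`):
above `i` the interval `(A, 1)` is cut into `i + 1` equal slots (the `i`-th slot's lower end is
replaced by the one below), below `i` the interval `(0, A)` into `n + 1 − i` equal slots.
[folklore] -/
def lo (i : Fin (n + 1)) (A : ℝ) (j : Fin (n + 1)) : ℝ :=
  if (j : ℕ) < i then A + (1 - A) * ((i : ℝ) - j) / ((i : ℝ) + 1)
  else A * ((n : ℝ) - j) / ((n : ℝ) + 1 - i)

/-- Upper ends of the adapted grid box. [folklore] -/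
def hi (i : Fin (n + 1)) (A : ℝ) (j : Fin (n + 1)) : ℝ :=
  if (j : ℕ) ≤ i then A + (1 - A) * ((i : ℝ) - j + 1) / ((i : ℝ) + 1)
  else A * ((n : ℝ) + 1 - j) / ((n : ℝ) + 1 - i)

theorem lo_nonneg (i : Fin (n + 1)) {A : ℝ} (hA0 : 0 ≤ A) (hA1 : A ≤ 1) (j : Fin (n + 1)) :
    0 ≤ lo i A j := by
  unfold lo
  have hi' : ((i : ℕ) : ℝ) ≤ n := by exact_mod_cast Nat.lt_succ_iff.mp i.isLt
  have hj' : ((j : ℕ) : ℝ) ≤ n := by exact_mod_cast Nat.lt_succ_iff.mp j.isLt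
  split_ifs with h
  · have : ((j : ℕ) : ℝ) < i := by exact_mod_cast h
    have h2 : 0 ≤ (1 - A) * ((i : ℝ) - j) / ((i : ℝ) + 1) :=
      div_nonneg (mul_nonneg (by linarith) (by linarith)) (by positivity)
    linarith
  · push Not at h
    have : ((i : ℕ) : ℝ) ≤ j := by exact_mod_cast h
    exact div_nonneg (mul_nonneg hA0 (by linarith)) (by linarith)

theorem hi_le_one (i : Fin (n + 1)) {A : ℝ} (hA0 : 0 ≤ A) (hA1 : A ≤ 1) (j : Fin (n + 1)) :
    hi i A j ≤ 1 := by
  unfold hi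
  have hi' : ((i : ℕ) : ℝ) ≤ n := by exact_mod_cast Nat.lt_succ_iff.mp i.isLt
  split_ifs with h
  · have : ((j : ℕ) : ℝ) ≤ i := by exact_mod_cast h
    have h2 : (1 - A) * ((i : ℝ) - j + 1) / ((i : ℝ) + 1) ≤ (1 - A) := by
      rw [div_le_iff₀ (by positivity)]
      nlinarith
    linarith
  · push Not at h
    have : ((i : ℕ) : ℝ) < j := by exact_mod_cast h
    have h2 : A * ((n : ℝ) + 1 - j) / ((n : ℝ) + 1 - i) ≤ A := by
      rw [div_le_iff₀ (by linarith)]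
      nlinarith
    linarith

/-- Consecutive slots touch: `lo (castSucc j) = hi (succ j)`. [folklore] -/
theorem lo_castSucc_eq_hi_succ (i : Fin (n + 1)) (A : ℝ) (j : Fin n) :
    lo i A (Fin.castSucc j) = hi i A j.succ := by
  unfold lo hi
  simp only [Fin.val_castSucc, Fin.val_succ, Nat.cast_add, Nat.cast_one]
  by_cases h : (j : ℕ) < i
  · rw [if_pos h, if_pos (by omega)]
    ring
  · rw [if_neg h, if_neg (by omega)]
    ring

/-- Slots are non-degenerate under the side conditions of a bad letter:
`A < 1` unless `i = 0`, and `0 < A` unless `i = n`. [folklore] -/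
theorem lo_lt_hi (i : Fin (n + 1)) {A : ℝ} (hA0 : 0 ≤ A) (hA1 : A ≤ 1)
    (hAi : A < 1 ∨ (i : ℕ) = 0) (hAi' : 0 < A ∨ (i : ℕ) = n) (j : Fin (n + 1)) :
    lo i A j < hi i A j := by
  unfold lo hi
  have hi' : ((i : ℕ) : ℝ) ≤ n := by exact_mod_cast Nat.lt_succ_iff.mp i.isLt
  have hj' : ((j : ℕ) : ℝ) ≤ n := by exact_mod_cast Nat.lt_succ_iff.mp j.isLt
  rcases lt_trichotomy (j : ℕ) i with h | h | h
  · rw [if_pos h, if_pos h.le]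
    have hA : A < 1 := by
      rcases hAi with h' | h'
      · exact h'
      · omega
    have : ((j : ℕ) : ℝ) < i := by exact_mod_cast h
    have hlt : (1 - A) * ((i : ℝ) - j) / ((i : ℝ) + 1) < (1 - A) * ((i : ℝ) - j + 1) / ((i : ℝ) + 1) :=
      div_lt_div_of_pos_right (by nlinarith) (by positivity)
    linarith
  · rw [if_neg (by omega), if_pos h.le]
    have : ((j : ℕ) : ℝ) = i := by exact_mod_cast h
    rw [this]
    have hden : (0 : ℝ) < (n : ℝ) + 1 - i := by linarith
    rcases lt_or_eq_of_le hA1 with hA | hA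
    · have h1 : A * ((n : ℝ) - i) / ((n : ℝ) + 1 - i) ≤ A := by
        rw [div_le_iff₀ hden]; nlinarith
      have h2 : 0 < (1 - A) * ((i : ℝ) - i + 1) / ((i : ℝ) + 1) :=
        div_pos (mul_pos (by linarith) (by linarith)) (by positivity)
      linarith
    · subst hA
      have h1 : (1 : ℝ) * ((n : ℝ) - i) / ((n : ℝ) + 1 - i) < 1 := by
        rw [div_lt_one hden]; linarith
      have h2 : (1 - (1 : ℝ)) * ((i : ℝ) - i + 1) / ((i : ℝ) + 1) = 0 := by simp
      linarith
  · rw [if_neg (by omega), if_neg (by omega)]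
    have hA : 0 < A := by
      rcases hAi' with h' | h'
      · exact h'
      · omega
    have : ((i : ℕ) : ℝ) < j := by exact_mod_cast h
    rw [div_lt_div_iff_of_pos_right (by linarith)]
    nlinarith

/-- The pivot lies in the closed `i`-th slot. [folklore] -/
theorem pivot_mem_Icc (i : Fin (n + 1)) {A : ℝ} (hA0 : 0 ≤ A) (hA1 : A ≤ 1) :
    A ∈ Icc (lo i A i) (hi i A i) := by
  unfold lo hi
  have hi' : ((i : ℕ) : ℝ) ≤ n := by exact_mod_cast Nat.lt_succ_iff.mp i.isLt
  rw [if_neg (lt_irrefl _), if_pos le_rfl]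
  constructor
  · rw [div_le_iff₀ (by linarith)]; nlinarith
  · have : 0 ≤ (1 - A) * ((i : ℝ) - i + 1) / ((i : ℝ) + 1) :=
      div_nonneg (mul_nonneg (by linarith) (by linarith)) (by positivity)
    linarith

/-- **The adapted box lies in the open ordered simplex.** [folklore] -/
theorem box_subset_simplex (i : Fin (n + 1)) {A : ℝ} (hA0 : 0 ≤ A) (hA1 : A ≤ 1) :
    (Set.pi univ fun j => Ioo (lo i A j) (hi i A j)) ⊆
      {t : Fin (n + 1) → ℝ | (∀ j, 0 < t j) ∧ (∀ j, t j < 1) ∧ StrictAnti t} := by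
  intro t ht
  rw [mem_univ_pi] at ht
  refine ⟨fun j => (lo_nonneg i hA0 hA1 j).trans_lt (ht j).1,
    fun j => (ht j).2.trans_le (hi_le_one i hA0 hA1 j), ?_⟩
  rw [Fin.strictAnti_iff_succ_lt]
  intro j
  calc t j.succ < hi i A j.succ := (ht j.succ).2
    _ = lo i A (Fin.castSucc j) := (lo_castSucc_eq_hi_succ i A j).symm
    _ < t (Fin.castSucc j) := (ht (Fin.castSucc j)).1

/-! ## The tightness theorem -/

/-- Off the hyperplane `tⱼ = aⱼ`, for `tⱼ ∈ (0,1)`: `(1 + |aⱼ|)⁻¹ ≤ |1/(tⱼ − aⱼ)|`. [folklore] -/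
theorem inv_one_add_abs_le {x a : ℝ} (h0 : 0 < x) (h1 : x < 1) (hne : x ≠ a) :
    (1 + |a|)⁻¹ ≤ |1 / (x - a)| := by
  rw [abs_one_div, one_div]
  apply inv_anti₀ (abs_pos.mpr (sub_ne_zero.mpr hne))
  calc |x - a| ≤ |x| + |a| := abs_sub x a
    _ ≤ 1 + |a| := by rw [abs_of_pos h0]; linarith

/-- **TIGHTNESS in every weight.** A word representation `[Δ_w, q · ∏ᵢ 1/(tᵢ − aᵢ)]` with `q ≠ 0`
(absolutely convergent, being an `IntegralRep`) has an admissible word: every letter avoids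
`(0,1)`, the first letter is `≠ 1`, the last letter is `≠ 0`. [folklore] -/
theorem wordRep_admissible {w : ℕ} (a : Fin w → ℚ) (q : ℚ) (s : KZ.IntegralRep w)
    (hdom : s.domain = {t | (∀ i, 0 < t i) ∧ (∀ i, t i < 1) ∧ StrictAnti t})
    (hint : EqOn s.integrand (fun t => (q : ℝ) * ∏ i, 1 / (t i - (a i : ℝ))) s.domain)
    (hq : q ≠ 0) (i : Fin w) :
    (a i : ℝ) ∉ Ioo (0 : ℝ) 1 ∧ ((i : ℕ) = 0 → a i ≠ 1) ∧ ((i : ℕ) = w - 1 → a i ≠ 0) := by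
  classical
  cases w with
  | zero => exact i.elim0
  | succ n =>
  -- reduce the three failure modes to: pivot `A ∈ [0,1]` with the two side conditions
  by_contra hbad
  have hbad' : ∃ A : ℝ, A = (a i : ℝ) ∧ 0 ≤ A ∧ A ≤ 1 ∧ (A < 1 ∨ (i : ℕ) = 0) ∧ (0 < A ∨ (i : ℕ) = n) := by
    simp only [not_and_or, not_not, Classical.not_imp] at hbad
    rcases hbad with h | ⟨h0, h1⟩ | ⟨hn, h0⟩
    · exact ⟨a i, rfl, h.1.le, h.2.le, Or.inl h.2, Or.inl h.1⟩
    · refine ⟨a i, rfl, ?_, ?_, Or.inr h0, Or.inl ?_⟩ <;> simp [h1]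
    · refine ⟨a i, rfl, ?_, ?_, Or.inl ?_, Or.inr (by omega)⟩ <;> simp [h0]
  obtain ⟨A, hAa, hA0, hA1, hAi, hAi'⟩ := hbad'
  set l : Fin (n + 1) → ℝ := lo i A with hl
  set u : Fin (n + 1) → ℝ := hi i A with hu
  set box : Set (Fin (n + 1) → ℝ) := Set.pi univ fun j => Ioo (l j) (u j) with hbox
  have hlu : ∀ j, l j < u j := fun j => lo_lt_hi i hA0 hA1 hAi hAi' j
  have hsub : box ⊆ s.domain := by rw [hdom]; exact box_subset_simplex i hA0 hA1
  have hmeas : MeasurableSet box := MeasurableSet.univ_pi fun _ => measurableSet_Ioo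
  -- the integrand on the box and its a.e. lower bound
  set C : ℝ := |(q : ℝ)| * ∏ j ∈ Finset.univ.erase i, (1 + |(a j : ℝ)|)⁻¹ with hC
  have hCpos : 0 < C := by
    rw [hC]
    refine mul_pos (abs_pos.mpr (by exact_mod_cast hq)) (Finset.prod_pos fun j _ => ?_)
    positivity
  have hf : IntegrableOn s.integrand box := s.integrableOn.mono_set hsub
  have hplanes : ∀ᵐ t ∂(volume.restrict box), ∀ j, t j ≠ (a j : ℝ) := by
    refine ae_restrict_of_ae ?_
    rw [ae_all_iff]
    intro j
    have := Measure.ae_eval_ne (fun _ : Fin (n + 1) => (volume : Measure ℝ)) j (a j : ℝ)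
    rwa [← volume_pi] at this
  have hbound : ∀ᵐ t ∂(volume.restrict box), C * |t i - A|⁻¹ ≤ ‖s.integrand t‖ := by
    filter_upwards [ae_restrict_mem hmeas, hplanes] with t ht hne
    have htd : t ∈ s.domain := hsub ht
    have ht' := (box_subset_simplex i hA0 hA1) ht
    rw [hint htd, norm_mul, Real.norm_eq_abs, Real.norm_eq_abs, Finset.abs_prod,
      ← Finset.mul_prod_erase Finset.univ (fun j => |1 / (t j - (a j : ℝ))|) (Finset.mem_univ i),
      hC, hAa]
    rw [show (|(q : ℝ)| * ∏ j ∈ Finset.univ.erase i, (1 + |(a j : ℝ)|)⁻¹) * |t i - (a i : ℝ)|⁻¹ =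
        |(q : ℝ)| * (|t i - (a i : ℝ)|⁻¹ * ∏ j ∈ Finset.univ.erase i, (1 + |(a j : ℝ)|)⁻¹) by ring]
    refine mul_le_mul_of_nonneg_left ?_ (abs_nonneg _)
    have hii : |t i - (a i : ℝ)|⁻¹ = |1 / (t i - (a i : ℝ))| := by rw [abs_one_div, one_div]
    rw [hii]
    refine mul_le_mul_of_nonneg_left ?_ (abs_nonneg _)
    exact Finset.prod_le_prod (fun j _ => by positivity)
      fun j _ => inv_one_add_abs_le (ht'.1 j) (ht'.2.1 j) (hne j)
  exact false_of_inv_le l u hlu i (by rw [hl, hu]; exact pivot_mem_Icc i hA0 hA1) hCpos hf hbound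

end Summit.KontsevichZagierPeriods.ArrangementNormalForm.WordTight
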